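import Literature.NumberTheory.Sieve.DrappeauDispersionR1ppSumMatch
import Literature.NumberTheory.Sieve.DrappeauDispersionR1ppCruxHyps
import Literature.NumberTheory.Sieve.DrappeauDispersionR1ppCoefBounds
import HarnessLib

/-!
# Drappeau 2017, §5.5: Theorem 2.1 applied to the blocked pieces of `ℛ₁''` ((5.24))

Topic `Literature/NumberTheory/Sieve`, part of the formalisation of §5 of S. Drappeau, Proc. London
Math. Soc. (3) 114 (2017) 684–732 = arXiv:1504.05549, p. 21: "We can therefore apply Theorem 2.1
with 𝐪 ← a₂n₀, … getting … (5.24)".  Given the conclusion of Theorem 2.1 (in the form of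
Assing–Blomer–Li, Thm 2.3, `a = 1`) as a hypothesis `hcrux` (for fixed `ε, ε₀`, the derivative
constants `KnuFamily Λ` and an implied constant `A`, total exponent `e`), each blocked piece of
`ℛ₁''` — positive block directly (`pieceSumBlk_eq_cruxLHS_pos`), negative block after complex
conjugation (`conj_pieceSumBlk_eq_cruxLHS_neg`) — is at most the right-hand side of Theorem 2.1 at
`𝐪 = |a₂|n₀`, `c₀ = λ₂δ₂⁻¹`, `d₀ = λ₁δ₁⁻¹`, `C = C_j`, `D = C_i`, `𝐍 = 2^{k+1}`, `R = |a₂|δ₁N`,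
`𝐒 = δ₂N/n₀`, `b = bCoef` (resp. `bGen … (conj ∘ value)`), `g = drWeight …`
(`drWeight_cruxHyps_XY`, `drWeight_support_XY`, `G_eq_drWeight_XY`, `bGen_support`).
Everything proved (no definition, no named fact); one statement per piece pair and sign.

## References

* S. Drappeau, Proc. London Math. Soc. (3) 114 (2017) 684–732, arXiv:1504.05549, §5.5 p. 21,
  (5.24). [cite: Drappeau2017, §5.5]
* E. Assing, V. Blomer, J. Li, Adv. Math. 393 (2021), Theorem 2.3. [cite: AssingBlomerLi2020, Theorem 2.3]
-/

noncomputable section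

open Finset Real Complex
open scoped ArithmeticFunction.Moebius FourierTransform

namespace Literature.NumberTheory.Sieve

namespace Drappeau2017

open KloostermanQuintilinear

/-- **A blocked piece of `ℛ₁''` (pieces `LL`, positive block) is bounded by the right-hand side of
Theorem 2.1** (`𝐪 = |a₂|n₀`, `C = C_j`, `D = C_i`, `𝐍 = 2^{k+1}`, `R = |a₂|δ₁N`, `𝐒 = δ₂N/n₀`).
[cite: Drappeau2017, §5.5 p. 21, (5.24)] -/
theorem blk_le_crux_LL_pos {S Y N M ξ : ℝ} (hY : 0 < Y) (hYS : Y ≤ S / 4) (hN : 0 < N)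
    (hM : 0 ≤ M) (hξ : 0 ≤ ξ) {a₁ a₂ : ℤ} (ha₂ : a₂ ≠ 0) {q₀ n₀ : ℕ} (hq₀ : 0 < q₀) (hn₀ : 0 < n₀)
    (hq₀n₀ : Nat.Coprime q₀ n₀) (hq₀a₂ : IsCoprime (q₀ : ℤ) a₂)
    {l₁ l₂ : ℕ} (hl₁ : Nat.Coprime l₁ (a₂.natAbs * n₀)) (hl₂ : Nat.Coprime l₂ (a₂.natAbs * n₀))
    (hl₁lt : l₁ < a₂.natAbs * n₀) (hl₂lt : l₂ < a₂.natAbs * n₀)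
    {δ₁ δ₂ : ℕ} (hδ₁ : 0 < δ₁) (hδ₂ : 0 < δ₂) (hδ₁m : Nat.Coprime δ₁ (a₂.natAbs * n₀))
    (hδ₂m : Nat.Coprime δ₂ (a₂.natAbs * n₀))
    {β : ℕ → ℂ} (hβ : ∀ n, ¬Squarefree n → β n = 0) (H k : ℕ)
    (hC1 : (1 : ℝ) ≤ (29 / 40 * S / ((q₀ : ℝ) * δ₂))) (hD1 : (1 : ℝ) ≤ (29 / 40 * S / ((q₀ : ℝ) * δ₁)))
    (hR1 : (1 : ℝ) ≤ (a₂.natAbs : ℝ) * δ₁ * N) (hS1 : (1 : ℝ) ≤ (δ₂ : ℝ) * N / n₀)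
    {ε₀ Λ : ℝ} (hε₀ : 0 ≤ ε₀) (hε₀1 : ε₀ ≤ 1) (hΛ : 0 ≤ Λ)
    (hΛt : ∀ t : ℝ, (S - Y) / ((q₀ : ℝ) * ((δ₁ : ℝ) * δ₂)) ≤ t →
      (2 * S + Y) / Y + 29 + 3 ≤ Λ * t ^ ε₀)
    {A e : ℝ}
    (hcrux : (∀ C D N R S : ℝ, 1 ≤ C → 1 ≤ D → 1 ≤ N → 1 ≤ R → 1 ≤ S →
      ∀ q c₀ d₀ : ℕ, 0 < q → Nat.Coprime (c₀ * d₀) q →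
      ∀ b : ℕ → ℕ → ℕ → ℂ,
        (∀ n r s : ℕ, b n r s ≠ 0 →
          (0 < n ∧ (n : ℝ) ≤ N ∧ R < r ∧ (r : ℝ) ≤ 2 * R ∧ S < s ∧ (s : ℝ) ≤ 2 * S)) →
      ∀ g : ℝ → ℝ → ℝ → ℝ → ℝ → ℂ,
        ContDiff ℝ (⊤ : ℕ∞) (fun p : Fin 5 → ℝ => g (p 0) (p 1) (p 2) (p 3) (p 4)) →
        HasCompactSupport (fun p : Fin 5 → ℝ => g (p 0) (p 1) (p 2) (p 3) (p 4)) →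
        (∀ c d n r s : ℝ, g c d n r s ≠ 0 →
          (C < c ∧ c ≤ 2 * C ∧ D < d ∧ d ≤ 2 * D ∧ 0 < n ∧ 0 < r ∧ 0 < s)) →
        (∀ ν : Fin 5 → ℕ, ∀ c d n r s : ℝ, 0 < c → 0 < d → 0 < n → 0 < r → 0 < s →
          ‖mixedDeriv ν g c d n r s‖ ≤ KnuFamily Λ ν *
            (c ^ (-(ν 0 : ℝ)) * d ^ (-(ν 1 : ℝ)) * n ^ (-(ν 2 : ℝ)) * r ^ (-(ν 3 : ℝ)) *
              s ^ (-(ν 4 : ℝ))) ^ (1 - ε₀)) →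
        ‖∑ c ∈ Finset.Icc 1 ⌊2 * C⌋₊, ∑ d ∈ Finset.Icc 1 ⌊2 * D⌋₊, ∑ n ∈ Finset.Icc 1 ⌊N⌋₊, ∑ r ∈ Finset.Icc 1 ⌊2 * R⌋₊,
            ∑ s ∈ Finset.Icc 1 ⌊2 * S⌋₊,
            (if (c ≡ c₀ [MOD q] ∧ d ≡ d₀ [MOD q] ∧ Nat.Coprime (q * r * d) (s * c)) then
              b n r s * g c d n r s *
                (𝐞 ((n : ℝ) * ((((r * d : ℕ) : ZMod (s * c))⁻¹).val : ℝ) / ((s : ℝ) * c)) : ℂ)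
            else 0)‖ ≤
          A * ((q : ℝ) * C * D * N * R * S) ^ e * (q : ℝ) ^ (3 / 2 : ℝ) *
            Real.sqrt
              ((q : ℝ) ^ 2 * (C * S * (R * S + N) * (C + R * D) + S * N * R) *
                  (∑ n ∈ Finset.Icc 1 ⌊N⌋₊, ∑ r ∈ Finset.Icc 1 ⌊2 * R⌋₊, ∑ s ∈ Finset.Icc 1 ⌊2 * S⌋₊, ‖b n r s‖ ^ 2) +
                (q : ℝ) * (C ^ 2 * D * S * Real.sqrt (R * (R * S + N)) + D ^ 2 * N * R) *
                  (∑ n ∈ Finset.Icc 1 ⌊N⌋₊, ∑ r ∈ Finset.Icc 1 ⌊2 * R⌋₊, ∑ s ∈ Finset.Icc 1 ⌊2 * S⌋₊, ‖b n r s‖ ^ 2)))) :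
    ‖pieceSumBlk a₁ a₂ (((((((BFI.mRange S Y).filter (fun q : ℕ => 0 < q)).filter (fun q : ℕ => IsCoprime (q : ℤ) a₂)).filter (fun q : ℕ => q₀ ∣ q)).image (fun q : ℕ => q / q₀)).filter (fun q : ℕ => q % (a₂.natAbs * n₀) = l₁)).filter (fun q : ℕ => δ₁ ∣ q))
        (((((((BFI.mRange S Y).filter (fun q : ℕ => 0 < q)).filter (fun q : ℕ => IsCoprime (q : ℤ) a₂)).filter (fun q : ℕ => q₀ ∣ q)).image (fun q : ℕ => q / q₀)).filter (fun q : ℕ => q % (a₂.natAbs * n₀) = l₂)).filter (fun q : ℕ => δ₂ ∣ q)) ((((BFI.dyadic N).filter (fun n : ℕ => IsCoprime (n : ℤ) a₂)).filter (fun n : ℕ => n₀ ∣ n)).image (fun n : ℕ => n / n₀))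
        q₀ n₀ l₁ l₂ β ξ (fun q₁ q₂ : ℕ => pieceLo S Y q₀ q₁ * pieceLo S Y q₀ q₂ *
          alphaProfile ((q₀ : ℝ) * ξ / M * q₁ * q₂)) H 1 (2 ^ k) (2 ^ (k + 1))‖ ≤
      A * (((a₂.natAbs * n₀ : ℕ) : ℝ) * (29 / 40 * S / ((q₀ : ℝ) * δ₂)) * (29 / 40 * S / ((q₀ : ℝ) * δ₁)) * ((2 ^ (k + 1) : ℕ) : ℝ) * ((a₂.natAbs : ℝ) * δ₁ * N) * ((δ₂ : ℝ) * N / n₀)) ^ e * ((a₂.natAbs * n₀ : ℕ) : ℝ) ^ (3 / 2 : ℝ) *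
        Real.sqrt (((a₂.natAbs * n₀ : ℕ) : ℝ) ^ 2 * ((29 / 40 * S / ((q₀ : ℝ) * δ₂)) * ((δ₂ : ℝ) * N / n₀) * (((a₂.natAbs : ℝ) * δ₁ * N) * ((δ₂ : ℝ) * N / n₀) + ((2 ^ (k + 1) : ℕ) : ℝ)) * ((29 / 40 * S / ((q₀ : ℝ) * δ₂)) + ((a₂.natAbs : ℝ) * δ₁ * N) * (29 / 40 * S / ((q₀ : ℝ) * δ₁))) + ((δ₂ : ℝ) * N / n₀) * ((2 ^ (k + 1) : ℕ) : ℝ) * ((a₂.natAbs : ℝ) * δ₁ * N)) *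
              (∑ n ∈ Finset.Icc 1 ⌊((2 ^ (k + 1) : ℕ) : ℝ)⌋₊, ∑ r ∈ Finset.Icc 1 ⌊2 * ((a₂.natAbs : ℝ) * δ₁ * N)⌋₊, ∑ s ∈ Finset.Icc 1 ⌊2 * ((δ₂ : ℝ) * N / n₀)⌋₊, ‖(bCoef a₁ a₂ ((((BFI.dyadic N).filter (fun n : ℕ => IsCoprime (n : ℤ) a₂)).filter (fun n : ℕ => n₀ ∣ n)).image (fun n : ℕ => n / n₀)) q₀ n₀ l₁ l₂ β ξ H 1 (2 ^ k) (2 ^ (k + 1)) δ₁ δ₂) n r s‖ ^ 2) +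
            ((a₂.natAbs * n₀ : ℕ) : ℝ) * ((29 / 40 * S / ((q₀ : ℝ) * δ₂)) ^ 2 * (29 / 40 * S / ((q₀ : ℝ) * δ₁)) * ((δ₂ : ℝ) * N / n₀) * Real.sqrt (((a₂.natAbs : ℝ) * δ₁ * N) * (((a₂.natAbs : ℝ) * δ₁ * N) * ((δ₂ : ℝ) * N / n₀) + ((2 ^ (k + 1) : ℕ) : ℝ))) + (29 / 40 * S / ((q₀ : ℝ) * δ₁)) ^ 2 * ((2 ^ (k + 1) : ℕ) : ℝ) * ((a₂.natAbs : ℝ) * δ₁ * N)) *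
              (∑ n ∈ Finset.Icc 1 ⌊((2 ^ (k + 1) : ℕ) : ℝ)⌋₊, ∑ r ∈ Finset.Icc 1 ⌊2 * ((a₂.natAbs : ℝ) * δ₁ * N)⌋₊, ∑ s ∈ Finset.Icc 1 ⌊2 * ((δ₂ : ℝ) * N / n₀)⌋₊, ‖(bCoef a₁ a₂ ((((BFI.dyadic N).filter (fun n : ℕ => IsCoprime (n : ℤ) a₂)).filter (fun n : ℕ => n₀ ∣ n)).image (fun n : ℕ => n / n₀)) q₀ n₀ l₁ l₂ β ξ H 1 (2 ^ k) (2 ^ (k + 1)) δ₁ δ₂) n r s‖ ^ 2)) := by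
  have hm : 0 < a₂.natAbs * n₀ := Nat.mul_pos (Int.natAbs_pos.2 ha₂) hn₀
  haveI : NeZero (a₂.natAbs * n₀) := ⟨hm.ne'⟩
  -- the classes `c₀ = λ₂ δ₂⁻¹`, `d₀ = λ₁ δ₁⁻¹`
  have hδ₂u : IsUnit ((δ₂ : ℕ) : ZMod (a₂.natAbs * n₀)) := (ZMod.isUnit_iff_coprime _ _).2 hδ₂m
  have hδ₁u : IsUnit ((δ₁ : ℕ) : ZMod (a₂.natAbs * n₀)) := (ZMod.isUnit_iff_coprime _ _).2 hδ₁m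
  have hl₂u : IsUnit ((l₂ : ℕ) : ZMod (a₂.natAbs * n₀)) := (ZMod.isUnit_iff_coprime _ _).2 hl₂
  have hl₁u : IsUnit ((l₁ : ℕ) : ZMod (a₂.natAbs * n₀)) := (ZMod.isUnit_iff_coprime _ _).2 hl₁
  set c₀ : ℕ := (((l₂ : ℕ) : ZMod (a₂.natAbs * n₀)) * (((δ₂ : ℕ) : ZMod (a₂.natAbs * n₀)))⁻¹).val
    with hc₀def
  set d₀ : ℕ := (((l₁ : ℕ) : ZMod (a₂.natAbs * n₀)) * (((δ₁ : ℕ) : ZMod (a₂.natAbs * n₀)))⁻¹).val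
    with hd₀def
  have hc₀ : δ₂ * c₀ ≡ l₂ [MOD a₂.natAbs * n₀] := by
    rw [← ZMod.natCast_eq_natCast_iff, Nat.cast_mul, hc₀def, ZMod.natCast_zmod_val, mul_left_comm,
      ZMod.mul_inv_of_unit _ hδ₂u, mul_one]
  have hd₀ : δ₁ * d₀ ≡ l₁ [MOD a₂.natAbs * n₀] := by
    rw [← ZMod.natCast_eq_natCast_iff, Nat.cast_mul, hd₀def, ZMod.natCast_zmod_val, mul_left_comm,
      ZMod.mul_inv_of_unit _ hδ₁u, mul_one]
  have hcop : Nat.Coprime (c₀ * d₀) (a₂.natAbs * n₀) := by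
    refine Nat.Coprime.mul_left ?_ ?_
    · rw [← ZMod.isUnit_iff_coprime, hc₀def, ZMod.natCast_zmod_val]
      exact hl₂u.mul (IsUnit.of_mul_eq_one _ (ZMod.inv_mul_of_unit _ hδ₂u))
    · rw [← ZMod.isUnit_iff_coprime, hd₀def, ZMod.natCast_zmod_val]
      exact hl₁u.mul (IsUnit.of_mul_eq_one _ (ZMod.inv_mul_of_unit _ hδ₁u))
  -- the weight
  obtain ⟨hgcd, hghc, hgsup, hgder⟩ := drWeight_cruxHyps_LL hY hYS hq₀ hδ₁ hδ₂
    (κ := (q₀ : ℝ) * ξ / M * δ₁ * δ₂) (R := (a₂.natAbs : ℝ) * δ₁ * N) (S' := (δ₂ : ℝ) * N / n₀)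
    (by positivity) hR1 hS1 k hε₀ hε₀1 hΛ hΛt
  -- ranges
  have hIn : ∀ z : ℤ, (((2 ^ k : ℕ) : ℕ) : ℤ) ≤ z → z < (((2 ^ (k + 1) : ℕ) : ℕ) : ℤ) →
      z.toNat ∈ Finset.Icc 1 ⌊((2 ^ (k + 1) : ℕ) : ℝ)⌋₊ := by
    intro z h1 h2
    rw [Nat.floor_natCast, Finset.mem_Icc]
    have hk1 : 1 ≤ 2 ^ k := Nat.one_le_two_pow
    generalize (2 ^ k : ℕ) = u at h1 hk1
    generalize (2 ^ (k + 1) : ℕ) = v at h2 ⊢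
    constructor <;> omega
  have hIr : ∀ n₂ ∈ ((((BFI.dyadic N).filter (fun n : ℕ => IsCoprime (n : ℤ) a₂)).filter (fun n : ℕ => n₀ ∣ n)).image (fun n : ℕ => n / n₀)), a₂.natAbs * n₀ * δ₁ * n₂ ∈ Finset.Icc 1 ⌊2 * ((a₂.natAbs : ℝ) * δ₁ * N)⌋₊ := by
    intro n₂ hn₂
    obtain ⟨hpos, -, hdy⟩ := mem_Bset hN.le hn₀ hn₂
    have h2 := ((BFI.mem_dyadic hN.le).1 hdy).2
    rw [Finset.mem_Icc]
    refine ⟨Nat.one_le_iff_ne_zero.2 (Nat.pos_iff_ne_zero.1 (by positivity)), Nat.le_floor ?_⟩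
    push_cast at h2 ⊢
    have h0 : (0 : ℝ) ≤ (a₂.natAbs : ℝ) * δ₁ := by positivity
    calc (a₂.natAbs : ℝ) * n₀ * δ₁ * n₂ = (a₂.natAbs : ℝ) * δ₁ * ((n₀ : ℝ) * n₂) := by ring
      _ ≤ (a₂.natAbs : ℝ) * δ₁ * (2 * N) := mul_le_mul_of_nonneg_left h2 h0
      _ = 2 * ((a₂.natAbs : ℝ) * δ₁ * N) := by ring
  have hIs : ∀ n₁ ∈ ((((BFI.dyadic N).filter (fun n : ℕ => IsCoprime (n : ℤ) a₂)).filter (fun n : ℕ => n₀ ∣ n)).image (fun n : ℕ => n / n₀)), δ₂ * n₁ ∈ Finset.Icc 1 ⌊2 * ((δ₂ : ℝ) * N / n₀)⌋₊ := by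
    intro n₁ hn₁
    obtain ⟨hpos, -, hdy⟩ := mem_Bset hN.le hn₀ hn₁
    have h2 := ((BFI.mem_dyadic hN.le).1 hdy).2
    rw [Finset.mem_Icc]
    refine ⟨Nat.one_le_iff_ne_zero.2 (Nat.pos_iff_ne_zero.1 (by positivity)), Nat.le_floor ?_⟩
    have hn₀r : (0 : ℝ) < n₀ := by exact_mod_cast hn₀
    rw [show 2 * ((δ₂ : ℝ) * N / n₀) = (δ₂ : ℝ) * (2 * N) / n₀ by ring, le_div_iff₀ hn₀r]
    push_cast at h2 ⊢
    have h0 : (0 : ℝ) ≤ (δ₂ : ℝ) := by positivity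
    calc (δ₂ : ℝ) * n₁ * n₀ = (δ₂ : ℝ) * ((n₀ : ℝ) * n₁) := by ring
      _ ≤ (δ₂ : ℝ) * (2 * N) := mul_le_mul_of_nonneg_left h2 h0
  have h1N : (1 : ℝ) ≤ ((2 ^ (k + 1) : ℕ) : ℝ) := by exact_mod_cast Nat.one_le_two_pow
  -- the identity with the left-hand side of Theorem 2.1
  rw [pieceSumBlk_eq_cruxLHS_pos hN.le ha₂ hq₀ hn₀ hq₀n₀ hq₀a₂ hl₁ hl₂ hl₁lt hl₂lt hδ₁ hδ₂ hδ₁m hδ₂m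
    hc₀ hd₀ hβ ξ H (2 ^ k) (2 ^ (k + 1)) ⌊2 * (29 / 40 * S / ((q₀ : ℝ) * δ₂))⌋₊ ⌊2 * (29 / 40 * S / ((q₀ : ℝ) * δ₁))⌋₊ hIn hIr hIs
    (G := (fun q₁ q₂ : ℕ => pieceLo S Y q₀ q₁ * pieceLo S Y q₀ q₂ *
          alphaProfile ((q₀ : ℝ) * ξ / M * q₁ * q₂)))
    (g := (drWeight (pieceLo S Y ((q₀ : ℝ) * δ₂)) (pieceLo S Y ((q₀ : ℝ) * δ₁))
          ((q₀ : ℝ) * ξ / M * δ₁ * δ₂) ((2 : ℝ) ^ k) ((a₂.natAbs : ℝ) * δ₁ * N) ((δ₂ : ℝ) * N / n₀)))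
    (fun c d n r s h => drWeight_support_LL hY hYS hN ha₂ hq₀ hn₀ hδ₁ hδ₂ k c d n r s h)
    (fun c d n₁ hn₁ n₂ hn₂ h hlo hhi => G_eq_drWeight_LL hN ha₂ hn₀ hδ₁ hδ₂ 1
      (mem_Bset hN.le hn₀ hn₁).2.2 (mem_Bset hN.le hn₀ hn₂).2.2 h hlo hhi)]
  have hbsupp : ∀ n r s : ℕ, (bCoef a₁ a₂ ((((BFI.dyadic N).filter (fun n : ℕ => IsCoprime (n : ℤ) a₂)).filter (fun n : ℕ => n₀ ∣ n)).image (fun n : ℕ => n / n₀)) q₀ n₀ l₁ l₂ β ξ H 1 (2 ^ k) (2 ^ (k + 1)) δ₁ δ₂) n r s ≠ 0 →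
      (0 < n ∧ (n : ℝ) ≤ ((2 ^ (k + 1) : ℕ) : ℝ) ∧ ((a₂.natAbs : ℝ) * δ₁ * N) < r ∧
        (r : ℝ) ≤ 2 * ((a₂.natAbs : ℝ) * δ₁ * N) ∧ ((δ₂ : ℝ) * N / n₀) < s ∧
        (s : ℝ) ≤ 2 * ((δ₂ : ℝ) * N / n₀)) := by
    intro n r s hb
    rw [bCoef_eq_bGen] at hb
    exact bGen_support hN.le ha₂ hn₀ hδ₁ hδ₂ Nat.one_le_two_pow H _ hb
  exact hcrux (29 / 40 * S / ((q₀ : ℝ) * δ₂)) (29 / 40 * S / ((q₀ : ℝ) * δ₁)) ((2 ^ (k + 1) : ℕ) : ℝ) ((a₂.natAbs : ℝ) * δ₁ * N) ((δ₂ : ℝ) * N / n₀)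
    hC1 hD1 h1N hR1 hS1 (a₂.natAbs * n₀) c₀ d₀ hm hcop
    (bCoef a₁ a₂ ((((BFI.dyadic N).filter (fun n : ℕ => IsCoprime (n : ℤ) a₂)).filter (fun n : ℕ => n₀ ∣ n)).image (fun n : ℕ => n / n₀)) q₀ n₀ l₁ l₂ β ξ H 1 (2 ^ k) (2 ^ (k + 1)) δ₁ δ₂) hbsupp
    (drWeight (pieceLo S Y ((q₀ : ℝ) * δ₂)) (pieceLo S Y ((q₀ : ℝ) * δ₁))
          ((q₀ : ℝ) * ξ / M * δ₁ * δ₂) ((2 : ℝ) ^ k) ((a₂.natAbs : ℝ) * δ₁ * N) ((δ₂ : ℝ) * N / n₀)) hgcd hghc hgsup hgder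

/-- **A blocked piece of `ℛ₁''` (pieces `LL`, negative block) is bounded by the right-hand side of
Theorem 2.1** (`𝐪 = |a₂|n₀`, `C = C_j`, `D = C_i`, `𝐍 = 2^{k+1}`, `R = |a₂|δ₁N`, `𝐒 = δ₂N/n₀`).
[cite: Drappeau2017, §5.5 p. 21, (5.24)] -/
theorem blk_le_crux_LL_neg {S Y N M ξ : ℝ} (hY : 0 < Y) (hYS : Y ≤ S / 4) (hN : 0 < N)
    (hM : 0 ≤ M) (hξ : 0 ≤ ξ) {a₁ a₂ : ℤ} (ha₂ : a₂ ≠ 0) {q₀ n₀ : ℕ} (hq₀ : 0 < q₀) (hn₀ : 0 < n₀)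
    (hq₀n₀ : Nat.Coprime q₀ n₀) (hq₀a₂ : IsCoprime (q₀ : ℤ) a₂)
    {l₁ l₂ : ℕ} (hl₁ : Nat.Coprime l₁ (a₂.natAbs * n₀)) (hl₂ : Nat.Coprime l₂ (a₂.natAbs * n₀))
    (hl₁lt : l₁ < a₂.natAbs * n₀) (hl₂lt : l₂ < a₂.natAbs * n₀)
    {δ₁ δ₂ : ℕ} (hδ₁ : 0 < δ₁) (hδ₂ : 0 < δ₂) (hδ₁m : Nat.Coprime δ₁ (a₂.natAbs * n₀))
    (hδ₂m : Nat.Coprime δ₂ (a₂.natAbs * n₀))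
    {β : ℕ → ℂ} (hβ : ∀ n, ¬Squarefree n → β n = 0) (H k : ℕ)
    (hC1 : (1 : ℝ) ≤ (29 / 40 * S / ((q₀ : ℝ) * δ₂))) (hD1 : (1 : ℝ) ≤ (29 / 40 * S / ((q₀ : ℝ) * δ₁)))
    (hR1 : (1 : ℝ) ≤ (a₂.natAbs : ℝ) * δ₁ * N) (hS1 : (1 : ℝ) ≤ (δ₂ : ℝ) * N / n₀)
    {ε₀ Λ : ℝ} (hε₀ : 0 ≤ ε₀) (hε₀1 : ε₀ ≤ 1) (hΛ : 0 ≤ Λ)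
    (hΛt : ∀ t : ℝ, (S - Y) / ((q₀ : ℝ) * ((δ₁ : ℝ) * δ₂)) ≤ t →
      (2 * S + Y) / Y + 29 + 3 ≤ Λ * t ^ ε₀)
    {A e : ℝ}
    (hcrux : (∀ C D N R S : ℝ, 1 ≤ C → 1 ≤ D → 1 ≤ N → 1 ≤ R → 1 ≤ S →
      ∀ q c₀ d₀ : ℕ, 0 < q → Nat.Coprime (c₀ * d₀) q →
      ∀ b : ℕ → ℕ → ℕ → ℂ,
        (∀ n r s : ℕ, b n r s ≠ 0 →
          (0 < n ∧ (n : ℝ) ≤ N ∧ R < r ∧ (r : ℝ) ≤ 2 * R ∧ S < s ∧ (s : ℝ) ≤ 2 * S)) →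
      ∀ g : ℝ → ℝ → ℝ → ℝ → ℝ → ℂ,
        ContDiff ℝ (⊤ : ℕ∞) (fun p : Fin 5 → ℝ => g (p 0) (p 1) (p 2) (p 3) (p 4)) →
        HasCompactSupport (fun p : Fin 5 → ℝ => g (p 0) (p 1) (p 2) (p 3) (p 4)) →
        (∀ c d n r s : ℝ, g c d n r s ≠ 0 →
          (C < c ∧ c ≤ 2 * C ∧ D < d ∧ d ≤ 2 * D ∧ 0 < n ∧ 0 < r ∧ 0 < s)) →
        (∀ ν : Fin 5 → ℕ, ∀ c d n r s : ℝ, 0 < c → 0 < d → 0 < n → 0 < r → 0 < s →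
          ‖mixedDeriv ν g c d n r s‖ ≤ KnuFamily Λ ν *
            (c ^ (-(ν 0 : ℝ)) * d ^ (-(ν 1 : ℝ)) * n ^ (-(ν 2 : ℝ)) * r ^ (-(ν 3 : ℝ)) *
              s ^ (-(ν 4 : ℝ))) ^ (1 - ε₀)) →
        ‖∑ c ∈ Finset.Icc 1 ⌊2 * C⌋₊, ∑ d ∈ Finset.Icc 1 ⌊2 * D⌋₊, ∑ n ∈ Finset.Icc 1 ⌊N⌋₊, ∑ r ∈ Finset.Icc 1 ⌊2 * R⌋₊,
            ∑ s ∈ Finset.Icc 1 ⌊2 * S⌋₊,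
            (if (c ≡ c₀ [MOD q] ∧ d ≡ d₀ [MOD q] ∧ Nat.Coprime (q * r * d) (s * c)) then
              b n r s * g c d n r s *
                (𝐞 ((n : ℝ) * ((((r * d : ℕ) : ZMod (s * c))⁻¹).val : ℝ) / ((s : ℝ) * c)) : ℂ)
            else 0)‖ ≤
          A * ((q : ℝ) * C * D * N * R * S) ^ e * (q : ℝ) ^ (3 / 2 : ℝ) *
            Real.sqrt
              ((q : ℝ) ^ 2 * (C * S * (R * S + N) * (C + R * D) + S * N * R) *
                  (∑ n ∈ Finset.Icc 1 ⌊N⌋₊, ∑ r ∈ Finset.Icc 1 ⌊2 * R⌋₊, ∑ s ∈ Finset.Icc 1 ⌊2 * S⌋₊, ‖b n r s‖ ^ 2) +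
                (q : ℝ) * (C ^ 2 * D * S * Real.sqrt (R * (R * S + N)) + D ^ 2 * N * R) *
                  (∑ n ∈ Finset.Icc 1 ⌊N⌋₊, ∑ r ∈ Finset.Icc 1 ⌊2 * R⌋₊, ∑ s ∈ Finset.Icc 1 ⌊2 * S⌋₊, ‖b n r s‖ ^ 2)))) :
    ‖pieceSumBlk a₁ a₂ (((((((BFI.mRange S Y).filter (fun q : ℕ => 0 < q)).filter (fun q : ℕ => IsCoprime (q : ℤ) a₂)).filter (fun q : ℕ => q₀ ∣ q)).image (fun q : ℕ => q / q₀)).filter (fun q : ℕ => q % (a₂.natAbs * n₀) = l₁)).filter (fun q : ℕ => δ₁ ∣ q))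
        (((((((BFI.mRange S Y).filter (fun q : ℕ => 0 < q)).filter (fun q : ℕ => IsCoprime (q : ℤ) a₂)).filter (fun q : ℕ => q₀ ∣ q)).image (fun q : ℕ => q / q₀)).filter (fun q : ℕ => q % (a₂.natAbs * n₀) = l₂)).filter (fun q : ℕ => δ₂ ∣ q)) ((((BFI.dyadic N).filter (fun n : ℕ => IsCoprime (n : ℤ) a₂)).filter (fun n : ℕ => n₀ ∣ n)).image (fun n : ℕ => n / n₀))
        q₀ n₀ l₁ l₂ β ξ (fun q₁ q₂ : ℕ => pieceLo S Y q₀ q₁ * pieceLo S Y q₀ q₂ *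
          alphaProfile ((q₀ : ℝ) * ξ / M * q₁ * q₂)) H (-1) (2 ^ k) (2 ^ (k + 1))‖ ≤
      A * (((a₂.natAbs * n₀ : ℕ) : ℝ) * (29 / 40 * S / ((q₀ : ℝ) * δ₂)) * (29 / 40 * S / ((q₀ : ℝ) * δ₁)) * ((2 ^ (k + 1) : ℕ) : ℝ) * ((a₂.natAbs : ℝ) * δ₁ * N) * ((δ₂ : ℝ) * N / n₀)) ^ e * ((a₂.natAbs * n₀ : ℕ) : ℝ) ^ (3 / 2 : ℝ) *
        Real.sqrt (((a₂.natAbs * n₀ : ℕ) : ℝ) ^ 2 * ((29 / 40 * S / ((q₀ : ℝ) * δ₂)) * ((δ₂ : ℝ) * N / n₀) * (((a₂.natAbs : ℝ) * δ₁ * N) * ((δ₂ : ℝ) * N / n₀) + ((2 ^ (k + 1) : ℕ) : ℝ)) * ((29 / 40 * S / ((q₀ : ℝ) * δ₂)) + ((a₂.natAbs : ℝ) * δ₁ * N) * (29 / 40 * S / ((q₀ : ℝ) * δ₁))) + ((δ₂ : ℝ) * N / n₀) * ((2 ^ (k + 1) : ℕ) : ℝ) * ((a₂.natAbs : ℝ)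 * δ₁ * N)) *
              (∑ n ∈ Finset.Icc 1 ⌊((2 ^ (k + 1) : ℕ) : ℝ)⌋₊, ∑ r ∈ Finset.Icc 1 ⌊2 * ((a₂.natAbs : ℝ) * δ₁ * N)⌋₊, ∑ s ∈ Finset.Icc 1 ⌊2 * ((δ₂ : ℝ) * N / n₀)⌋₊, ‖(bGen a₁ a₂ ((((BFI.dyadic N).filter (fun n : ℕ => IsCoprime (n : ℤ) a₂)).filter (fun n : ℕ => n₀ ∣ n)).image (fun n : ℕ => n / n₀)) q₀ n₀ H (-1) (2 ^ k) (2 ^ (k + 1)) δ₁ δ₂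
            (fun h n₁ n₂ => starRingEnd ℂ (β (n₀ * n₁) * starRingEnd ℂ (β (n₀ * n₂)) *
              ((𝐞 (-(ξ * h)) : ℂ) *
                (𝐞 (-((h : ℝ) * a₁ *
                    ((((((q₀ : ℤ) * l₁ * l₂ * n₁ : ℤ) : ZMod (a₂.natAbs * n₀))⁻¹).val : ℕ) : ℝ) /
                      ((a₂ : ℝ) * n₀))) : ℂ))))) n r s‖ ^ 2) +
            ((a₂.natAbs * n₀ : ℕ) : ℝ) * ((29 / 40 * S / ((q₀ : ℝ) * δ₂)) ^ 2 * (29 / 40 * S / ((q₀ : ℝ) * δ₁)) * ((δ₂ : ℝ) * N / n₀) * Real.sqrt (((a₂.natAbs : ℝ) * δ₁ * N) * (((a₂.natAbs : ℝ) * δ₁ * N) * ((δ₂ : ℝ) * N / n₀) + ((2 ^ (k + 1) : ℕ) : ℝ))) + (29 / 40 * S / ((q₀ : ℝ) * δ₁)) ^ 2 * ((2 ^ (k + 1) : ℕ) : ℝ) * ((a₂.natAbs : ℝ) * δ₁ * N)) *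
              (∑ n ∈ Finset.Icc 1 ⌊((2 ^ (k + 1) : ℕ) : ℝ)⌋₊, ∑ r ∈ Finset.Icc 1 ⌊2 * ((a₂.natAbs : ℝ) * δ₁ * N)⌋₊, ∑ s ∈ Finset.Icc 1 ⌊2 * ((δ₂ : ℝ) * N / n₀)⌋₊, ‖(bGen a₁ a₂ ((((BFI.dyadic N).filter (fun n : ℕ => IsCoprime (n : ℤ) a₂)).filter (fun n : ℕ => n₀ ∣ n)).image (fun n : ℕ => n / n₀)) q₀ n₀ H (-1) (2 ^ k) (2 ^ (k + 1)) δ₁ δ₂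
            (fun h n₁ n₂ => starRingEnd ℂ (β (n₀ * n₁) * starRingEnd ℂ (β (n₀ * n₂)) *
              ((𝐞 (-(ξ * h)) : ℂ) *
                (𝐞 (-((h : ℝ) * a₁ *
                    ((((((q₀ : ℤ) * l₁ * l₂ * n₁ : ℤ) : ZMod (a₂.natAbs * n₀))⁻¹).val : ℕ) : ℝ) /
                      ((a₂ : ℝ) * n₀))) : ℂ))))) n r s‖ ^ 2)) := by
  have hm : 0 < a₂.natAbs * n₀ := Nat.mul_pos (Int.natAbs_pos.2 ha₂) hn₀
  haveI : NeZero (a₂.natAbs * n₀) := ⟨hm.ne'⟩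
  -- the classes `c₀ = λ₂ δ₂⁻¹`, `d₀ = λ₁ δ₁⁻¹`
  have hδ₂u : IsUnit ((δ₂ : ℕ) : ZMod (a₂.natAbs * n₀)) := (ZMod.isUnit_iff_coprime _ _).2 hδ₂m
  have hδ₁u : IsUnit ((δ₁ : ℕ) : ZMod (a₂.natAbs * n₀)) := (ZMod.isUnit_iff_coprime _ _).2 hδ₁m
  have hl₂u : IsUnit ((l₂ : ℕ) : ZMod (a₂.natAbs * n₀)) := (ZMod.isUnit_iff_coprime _ _).2 hl₂
  have hl₁u : IsUnit ((l₁ : ℕ) : ZMod (a₂.natAbs * n₀)) := (ZMod.isUnit_iff_coprime _ _).2 hl₁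
  set c₀ : ℕ := (((l₂ : ℕ) : ZMod (a₂.natAbs * n₀)) * (((δ₂ : ℕ) : ZMod (a₂.natAbs * n₀)))⁻¹).val
    with hc₀def
  set d₀ : ℕ := (((l₁ : ℕ) : ZMod (a₂.natAbs * n₀)) * (((δ₁ : ℕ) : ZMod (a₂.natAbs * n₀)))⁻¹).val
    with hd₀def
  have hc₀ : δ₂ * c₀ ≡ l₂ [MOD a₂.natAbs * n₀] := by
    rw [← ZMod.natCast_eq_natCast_iff, Nat.cast_mul, hc₀def, ZMod.natCast_zmod_val, mul_left_comm,
      ZMod.mul_inv_of_unit _ hδ₂u, mul_one]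
  have hd₀ : δ₁ * d₀ ≡ l₁ [MOD a₂.natAbs * n₀] := by
    rw [← ZMod.natCast_eq_natCast_iff, Nat.cast_mul, hd₀def, ZMod.natCast_zmod_val, mul_left_comm,
      ZMod.mul_inv_of_unit _ hδ₁u, mul_one]
  have hcop : Nat.Coprime (c₀ * d₀) (a₂.natAbs * n₀) := by
    refine Nat.Coprime.mul_left ?_ ?_
    · rw [← ZMod.isUnit_iff_coprime, hc₀def, ZMod.natCast_zmod_val]
      exact hl₂u.mul (IsUnit.of_mul_eq_one _ (ZMod.inv_mul_of_unit _ hδ₂u))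
    · rw [← ZMod.isUnit_iff_coprime, hd₀def, ZMod.natCast_zmod_val]
      exact hl₁u.mul (IsUnit.of_mul_eq_one _ (ZMod.inv_mul_of_unit _ hδ₁u))
  -- the weight
  obtain ⟨hgcd, hghc, hgsup, hgder⟩ := drWeight_cruxHyps_LL hY hYS hq₀ hδ₁ hδ₂
    (κ := (q₀ : ℝ) * ξ / M * δ₁ * δ₂) (R := (a₂.natAbs : ℝ) * δ₁ * N) (S' := (δ₂ : ℝ) * N / n₀)
    (by positivity) hR1 hS1 k hε₀ hε₀1 hΛ hΛt
  -- ranges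
  have hIn : ∀ z : ℤ, (((2 ^ k : ℕ) : ℕ) : ℤ) ≤ z → z < (((2 ^ (k + 1) : ℕ) : ℕ) : ℤ) →
      z.toNat ∈ Finset.Icc 1 ⌊((2 ^ (k + 1) : ℕ) : ℝ)⌋₊ := by
    intro z h1 h2
    rw [Nat.floor_natCast, Finset.mem_Icc]
    have hk1 : 1 ≤ 2 ^ k := Nat.one_le_two_pow
    generalize (2 ^ k : ℕ) = u at h1 hk1
    generalize (2 ^ (k + 1) : ℕ) = v at h2 ⊢
    constructor <;> omega
  have hIr : ∀ n₂ ∈ ((((BFI.dyadic N).filter (fun n : ℕ => IsCoprime (n : ℤ) a₂)).filter (fun n : ℕ => n₀ ∣ n)).image (fun n : ℕ => n / n₀)), a₂.natAbs * n₀ * δ₁ * n₂ ∈ Finset.Icc 1 ⌊2 * ((a₂.natAbs : ℝ) * δ₁ * N)⌋₊ := by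
    intro n₂ hn₂
    obtain ⟨hpos, -, hdy⟩ := mem_Bset hN.le hn₀ hn₂
    have h2 := ((BFI.mem_dyadic hN.le).1 hdy).2
    rw [Finset.mem_Icc]
    refine ⟨Nat.one_le_iff_ne_zero.2 (Nat.pos_iff_ne_zero.1 (by positivity)), Nat.le_floor ?_⟩
    push_cast at h2 ⊢
    have h0 : (0 : ℝ) ≤ (a₂.natAbs : ℝ) * δ₁ := by positivity
    calc (a₂.natAbs : ℝ) * n₀ * δ₁ * n₂ = (a₂.natAbs : ℝ) * δ₁ * ((n₀ : ℝ) * n₂) := by ring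
      _ ≤ (a₂.natAbs : ℝ) * δ₁ * (2 * N) := mul_le_mul_of_nonneg_left h2 h0
      _ = 2 * ((a₂.natAbs : ℝ) * δ₁ * N) := by ring
  have hIs : ∀ n₁ ∈ ((((BFI.dyadic N).filter (fun n : ℕ => IsCoprime (n : ℤ) a₂)).filter (fun n : ℕ => n₀ ∣ n)).image (fun n : ℕ => n / n₀)), δ₂ * n₁ ∈ Finset.Icc 1 ⌊2 * ((δ₂ : ℝ) * N / n₀)⌋₊ := by
    intro n₁ hn₁
    obtain ⟨hpos, -, hdy⟩ := mem_Bset hN.le hn₀ hn₁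
    have h2 := ((BFI.mem_dyadic hN.le).1 hdy).2
    rw [Finset.mem_Icc]
    refine ⟨Nat.one_le_iff_ne_zero.2 (Nat.pos_iff_ne_zero.1 (by positivity)), Nat.le_floor ?_⟩
    have hn₀r : (0 : ℝ) < n₀ := by exact_mod_cast hn₀
    rw [show 2 * ((δ₂ : ℝ) * N / n₀) = (δ₂ : ℝ) * (2 * N) / n₀ by ring, le_div_iff₀ hn₀r]
    push_cast at h2 ⊢
    have h0 : (0 : ℝ) ≤ (δ₂ : ℝ) := by positivity
    calc (δ₂ : ℝ) * n₁ * n₀ = (δ₂ : ℝ) * ((n₀ : ℝ) * n₁) := by ring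
      _ ≤ (δ₂ : ℝ) * (2 * N) := mul_le_mul_of_nonneg_left h2 h0
  have h1N : (1 : ℝ) ≤ ((2 ^ (k + 1) : ℕ) : ℝ) := by exact_mod_cast Nat.one_le_two_pow
  -- conjugate, then the identity with the left-hand side of Theorem 2.1
  rw [← Complex.norm_conj (pieceSumBlk a₁ a₂ (((((((BFI.mRange S Y).filter (fun q : ℕ => 0 < q)).filter (fun q : ℕ => IsCoprime (q : ℤ) a₂)).filter (fun q : ℕ => q₀ ∣ q)).image (fun q : ℕ => q / q₀)).filter (fun q : ℕ => q % (a₂.natAbs * n₀) = l₁)).filter (fun q : ℕ => δ₁ ∣ q))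
        (((((((BFI.mRange S Y).filter (fun q : ℕ => 0 < q)).filter (fun q : ℕ => IsCoprime (q : ℤ) a₂)).filter (fun q : ℕ => q₀ ∣ q)).image (fun q : ℕ => q / q₀)).filter (fun q : ℕ => q % (a₂.natAbs * n₀) = l₂)).filter (fun q : ℕ => δ₂ ∣ q)) ((((BFI.dyadic N).filter (fun n : ℕ => IsCoprime (n : ℤ) a₂)).filter (fun n : ℕ => n₀ ∣ n)).image (fun n : ℕ => n / n₀))
        q₀ n₀ l₁ l₂ β ξ (fun q₁ q₂ : ℕ => pieceLo S Y q₀ q₁ * pieceLo S Y q₀ q₂ *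
          alphaProfile ((q₀ : ℝ) * ξ / M * q₁ * q₂)) H (-1) (2 ^ k) (2 ^ (k + 1)))]
  rw [conj_pieceSumBlk_eq_cruxLHS_neg hN.le ha₂ hq₀ hn₀ hq₀n₀ hq₀a₂ hl₁ hl₂ hl₁lt hl₂lt hδ₁ hδ₂ hδ₁m hδ₂m
    hc₀ hd₀ hβ ξ H (2 ^ k) (2 ^ (k + 1)) ⌊2 * (29 / 40 * S / ((q₀ : ℝ) * δ₂))⌋₊ ⌊2 * (29 / 40 * S / ((q₀ : ℝ) * δ₁))⌋₊ hIn hIr hIs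
    (G := (fun q₁ q₂ : ℕ => pieceLo S Y q₀ q₁ * pieceLo S Y q₀ q₂ *
          alphaProfile ((q₀ : ℝ) * ξ / M * q₁ * q₂)))
    (g := (drWeight (pieceLo S Y ((q₀ : ℝ) * δ₂)) (pieceLo S Y ((q₀ : ℝ) * δ₁))
          ((q₀ : ℝ) * ξ / M * δ₁ * δ₂) ((2 : ℝ) ^ k) ((a₂.natAbs : ℝ) * δ₁ * N) ((δ₂ : ℝ) * N / n₀)))
    (fun c d n r s h => drWeight_support_LL hY hYS hN ha₂ hq₀ hn₀ hδ₁ hδ₂ k c d n r s h)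
    (conj_G_LL S Y ξ M q₀)
    (fun c d n₁ hn₁ n₂ hn₂ h hlo hhi => G_eq_drWeight_LL hN ha₂ hn₀ hδ₁ hδ₂ (-1)
      (mem_Bset hN.le hn₀ hn₁).2.2 (mem_Bset hN.le hn₀ hn₂).2.2 h hlo hhi)]
  have hbsupp : ∀ n r s : ℕ, (bGen a₁ a₂ ((((BFI.dyadic N).filter (fun n : ℕ => IsCoprime (n : ℤ) a₂)).filter (fun n : ℕ => n₀ ∣ n)).image (fun n : ℕ => n / n₀)) q₀ n₀ H (-1) (2 ^ k) (2 ^ (k + 1)) δ₁ δ₂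
            (fun h n₁ n₂ => starRingEnd ℂ (β (n₀ * n₁) * starRingEnd ℂ (β (n₀ * n₂)) *
              ((𝐞 (-(ξ * h)) : ℂ) *
                (𝐞 (-((h : ℝ) * a₁ *
                    ((((((q₀ : ℤ) * l₁ * l₂ * n₁ : ℤ) : ZMod (a₂.natAbs * n₀))⁻¹).val : ℕ) : ℝ) /
                      ((a₂ : ℝ) * n₀))) : ℂ))))) n r s ≠ 0 →
      (0 < n ∧ (n : ℝ) ≤ ((2 ^ (k + 1) : ℕ) : ℝ) ∧ ((a₂.natAbs : ℝ) * δ₁ * N) < r ∧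
        (r : ℝ) ≤ 2 * ((a₂.natAbs : ℝ) * δ₁ * N) ∧ ((δ₂ : ℝ) * N / n₀) < s ∧
        (s : ℝ) ≤ 2 * ((δ₂ : ℝ) * N / n₀)) :=
    fun n r s hb => bGen_support hN.le ha₂ hn₀ hδ₁ hδ₂ Nat.one_le_two_pow H _ hb
  exact hcrux (29 / 40 * S / ((q₀ : ℝ) * δ₂)) (29 / 40 * S / ((q₀ : ℝ) * δ₁)) ((2 ^ (k + 1) : ℕ) : ℝ) ((a₂.natAbs : ℝ) * δ₁ * N) ((δ₂ : ℝ) * N / n₀)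
    hC1 hD1 h1N hR1 hS1 (a₂.natAbs * n₀) c₀ d₀ hm hcop
    (bGen a₁ a₂ ((((BFI.dyadic N).filter (fun n : ℕ => IsCoprime (n : ℤ) a₂)).filter (fun n : ℕ => n₀ ∣ n)).image (fun n : ℕ => n / n₀)) q₀ n₀ H (-1) (2 ^ k) (2 ^ (k + 1)) δ₁ δ₂
            (fun h n₁ n₂ => starRingEnd ℂ (β (n₀ * n₁) * starRingEnd ℂ (β (n₀ * n₂)) *
              ((𝐞 (-(ξ * h)) : ℂ) *
                (𝐞 (-((h : ℝ) * a₁ *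
                    ((((((q₀ : ℤ) * l₁ * l₂ * n₁ : ℤ) : ZMod (a₂.natAbs * n₀))⁻¹).val : ℕ) : ℝ) /
                      ((a₂ : ℝ) * n₀))) : ℂ))))) hbsupp
    (drWeight (pieceLo S Y ((q₀ : ℝ) * δ₂)) (pieceLo S Y ((q₀ : ℝ) * δ₁))
          ((q₀ : ℝ) * ξ / M * δ₁ * δ₂) ((2 : ℝ) ^ k) ((a₂.natAbs : ℝ) * δ₁ * N) ((δ₂ : ℝ) * N / n₀)) hgcd hghc hgsup hgder

/-- **A blocked piece of `ℛ₁''` (pieces `LH`, positive block) is bounded by the right-hand side of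
Theorem 2.1** (`𝐪 = |a₂|n₀`, `C = C_j`, `D = C_i`, `𝐍 = 2^{k+1}`, `R = |a₂|δ₁N`, `𝐒 = δ₂N/n₀`).
[cite: Drappeau2017, §5.5 p. 21, (5.24)] -/
theorem blk_le_crux_LH_pos {S Y N M ξ : ℝ} (hY : 0 < Y) (hYS : Y ≤ S / 4) (hN : 0 < N)
    (hM : 0 ≤ M) (hξ : 0 ≤ ξ) {a₁ a₂ : ℤ} (ha₂ : a₂ ≠ 0) {q₀ n₀ : ℕ} (hq₀ : 0 < q₀) (hn₀ : 0 < n₀)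
    (hq₀n₀ : Nat.Coprime q₀ n₀) (hq₀a₂ : IsCoprime (q₀ : ℤ) a₂)
    {l₁ l₂ : ℕ} (hl₁ : Nat.Coprime l₁ (a₂.natAbs * n₀)) (hl₂ : Nat.Coprime l₂ (a₂.natAbs * n₀))
    (hl₁lt : l₁ < a₂.natAbs * n₀) (hl₂lt : l₂ < a₂.natAbs * n₀)
    {δ₁ δ₂ : ℕ} (hδ₁ : 0 < δ₁) (hδ₂ : 0 < δ₂) (hδ₁m : Nat.Coprime δ₁ (a₂.natAbs * n₀))
    (hδ₂m : Nat.Coprime δ₂ (a₂.natAbs * n₀))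
    {β : ℕ → ℂ} (hβ : ∀ n, ¬Squarefree n → β n = 0) (H k : ℕ)
    (hC1 : (1 : ℝ) ≤ (9 / 8 * S / ((q₀ : ℝ) * δ₂))) (hD1 : (1 : ℝ) ≤ (29 / 40 * S / ((q₀ : ℝ) * δ₁)))
    (hR1 : (1 : ℝ) ≤ (a₂.natAbs : ℝ) * δ₁ * N) (hS1 : (1 : ℝ) ≤ (δ₂ : ℝ) * N / n₀)
    {ε₀ Λ : ℝ} (hε₀ : 0 ≤ ε₀) (hε₀1 : ε₀ ≤ 1) (hΛ : 0 ≤ Λ)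
    (hΛt : ∀ t : ℝ, (S - Y) / ((q₀ : ℝ) * ((δ₁ : ℝ) * δ₂)) ≤ t →
      (2 * S + Y) / Y + 29 + 3 ≤ Λ * t ^ ε₀)
    {A e : ℝ}
    (hcrux : (∀ C D N R S : ℝ, 1 ≤ C → 1 ≤ D → 1 ≤ N → 1 ≤ R → 1 ≤ S →
      ∀ q c₀ d₀ : ℕ, 0 < q → Nat.Coprime (c₀ * d₀) q →
      ∀ b : ℕ → ℕ → ℕ → ℂ,
        (∀ n r s : ℕ, b n r s ≠ 0 →
          (0 < n ∧ (n : ℝ) ≤ N ∧ R < r ∧ (r : ℝ) ≤ 2 * R ∧ S < s ∧ (s : ℝ) ≤ 2 * S)) →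
      ∀ g : ℝ → ℝ → ℝ → ℝ → ℝ → ℂ,
        ContDiff ℝ (⊤ : ℕ∞) (fun p : Fin 5 → ℝ => g (p 0) (p 1) (p 2) (p 3) (p 4)) →
        HasCompactSupport (fun p : Fin 5 → ℝ => g (p 0) (p 1) (p 2) (p 3) (p 4)) →
        (∀ c d n r s : ℝ, g c d n r s ≠ 0 →
          (C < c ∧ c ≤ 2 * C ∧ D < d ∧ d ≤ 2 * D ∧ 0 < n ∧ 0 < r ∧ 0 < s)) →
        (∀ ν : Fin 5 → ℕ, ∀ c d n r s : ℝ, 0 < c → 0 < d → 0 < n → 0 < r → 0 < s →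
          ‖mixedDeriv ν g c d n r s‖ ≤ KnuFamily Λ ν *
            (c ^ (-(ν 0 : ℝ)) * d ^ (-(ν 1 : ℝ)) * n ^ (-(ν 2 : ℝ)) * r ^ (-(ν 3 : ℝ)) *
              s ^ (-(ν 4 : ℝ))) ^ (1 - ε₀)) →
        ‖∑ c ∈ Finset.Icc 1 ⌊2 * C⌋₊, ∑ d ∈ Finset.Icc 1 ⌊2 * D⌋₊, ∑ n ∈ Finset.Icc 1 ⌊N⌋₊, ∑ r ∈ Finset.Icc 1 ⌊2 * R⌋₊,
            ∑ s ∈ Finset.Icc 1 ⌊2 * S⌋₊,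
            (if (c ≡ c₀ [MOD q] ∧ d ≡ d₀ [MOD q] ∧ Nat.Coprime (q * r * d) (s * c)) then
              b n r s * g c d n r s *
                (𝐞 ((n : ℝ) * ((((r * d : ℕ) : ZMod (s * c))⁻¹).val : ℝ) / ((s : ℝ) * c)) : ℂ)
            else 0)‖ ≤
          A * ((q : ℝ) * C * D * N * R * S) ^ e * (q : ℝ) ^ (3 / 2 : ℝ) *
            Real.sqrt
              ((q : ℝ) ^ 2 * (C * S * (R * S + N) * (C + R * D) + S * N * R) *
                  (∑ n ∈ Finset.Icc 1 ⌊N⌋₊, ∑ r ∈ Finset.Icc 1 ⌊2 * R⌋₊, ∑ s ∈ Finset.Icc 1 ⌊2 * S⌋₊, ‖b n r s‖ ^ 2) +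
                (q : ℝ) * (C ^ 2 * D * S * Real.sqrt (R * (R * S + N)) + D ^ 2 * N * R) *
                  (∑ n ∈ Finset.Icc 1 ⌊N⌋₊, ∑ r ∈ Finset.Icc 1 ⌊2 * R⌋₊, ∑ s ∈ Finset.Icc 1 ⌊2 * S⌋₊, ‖b n r s‖ ^ 2)))) :
    ‖pieceSumBlk a₁ a₂ (((((((BFI.mRange S Y).filter (fun q : ℕ => 0 < q)).filter (fun q : ℕ => IsCoprime (q : ℤ) a₂)).filter (fun q : ℕ => q₀ ∣ q)).image (fun q : ℕ => q / q₀)).filter (fun q : ℕ => q % (a₂.natAbs * n₀) = l₁)).filter (fun q : ℕ => δ₁ ∣ q))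
        (((((((BFI.mRange S Y).filter (fun q : ℕ => 0 < q)).filter (fun q : ℕ => IsCoprime (q : ℤ) a₂)).filter (fun q : ℕ => q₀ ∣ q)).image (fun q : ℕ => q / q₀)).filter (fun q : ℕ => q % (a₂.natAbs * n₀) = l₂)).filter (fun q : ℕ => δ₂ ∣ q)) ((((BFI.dyadic N).filter (fun n : ℕ => IsCoprime (n : ℤ) a₂)).filter (fun n : ℕ => n₀ ∣ n)).image (fun n : ℕ => n / n₀))
        q₀ n₀ l₁ l₂ β ξ (fun q₁ q₂ : ℕ => pieceLo S Y q₀ q₁ * pieceHi S Y q₀ q₂ *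
          alphaProfile ((q₀ : ℝ) * ξ / M * q₁ * q₂)) H 1 (2 ^ k) (2 ^ (k + 1))‖ ≤
      A * (((a₂.natAbs * n₀ : ℕ) : ℝ) * (9 / 8 * S / ((q₀ : ℝ) * δ₂)) * (29 / 40 * S / ((q₀ : ℝ) * δ₁)) * ((2 ^ (k + 1) : ℕ) : ℝ) * ((a₂.natAbs : ℝ) * δ₁ * N) * ((δ₂ : ℝ) * N / n₀)) ^ e * ((a₂.natAbs * n₀ : ℕ) : ℝ) ^ (3 / 2 : ℝ) *
        Real.sqrt (((a₂.natAbs * n₀ : ℕ) : ℝ) ^ 2 * ((9 / 8 * S / ((q₀ : ℝ) * δ₂)) * ((δ₂ : ℝ) * N / n₀) * (((a₂.natAbs : ℝ) * δ₁ * N) * ((δ₂ : ℝ) * N / n₀) + ((2 ^ (k + 1) : ℕ) : ℝ)) * ((9 / 8 * S / ((q₀ : ℝ) * δ₂)) + ((a₂.natAbs : ℝ) * δ₁ * N) * (29 / 40 * S / ((q₀ : ℝ) * δ₁))) + ((δ₂ : ℝ) * N / n₀) * ((2 ^ (k + 1) : ℕ) : ℝ) * ((a₂.natAbs : ℝ)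 * δ₁ * N)) *
              (∑ n ∈ Finset.Icc 1 ⌊((2 ^ (k + 1) : ℕ) : ℝ)⌋₊, ∑ r ∈ Finset.Icc 1 ⌊2 * ((a₂.natAbs : ℝ) * δ₁ * N)⌋₊, ∑ s ∈ Finset.Icc 1 ⌊2 * ((δ₂ : ℝ) * N / n₀)⌋₊, ‖(bCoef a₁ a₂ ((((BFI.dyadic N).filter (fun n : ℕ => IsCoprime (n : ℤ) a₂)).filter (fun n : ℕ => n₀ ∣ n)).image (fun n : ℕ => n / n₀)) q₀ n₀ l₁ l₂ β ξ H 1 (2 ^ k) (2 ^ (k + 1)) δ₁ δ₂) n r s‖ ^ 2) +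
            ((a₂.natAbs * n₀ : ℕ) : ℝ) * ((9 / 8 * S / ((q₀ : ℝ) * δ₂)) ^ 2 * (29 / 40 * S / ((q₀ : ℝ) * δ₁)) * ((δ₂ : ℝ) * N / n₀) * Real.sqrt (((a₂.natAbs : ℝ) * δ₁ * N) * (((a₂.natAbs : ℝ) * δ₁ * N) * ((δ₂ : ℝ) * N / n₀) + ((2 ^ (k + 1) : ℕ) : ℝ))) + (29 / 40 * S / ((q₀ : ℝ) * δ₁)) ^ 2 * ((2 ^ (k + 1) : ℕ) : ℝ) * ((a₂.natAbs : ℝ) * δ₁ * N)) *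
              (∑ n ∈ Finset.Icc 1 ⌊((2 ^ (k + 1) : ℕ) : ℝ)⌋₊, ∑ r ∈ Finset.Icc 1 ⌊2 * ((a₂.natAbs : ℝ) * δ₁ * N)⌋₊, ∑ s ∈ Finset.Icc 1 ⌊2 * ((δ₂ : ℝ) * N / n₀)⌋₊, ‖(bCoef a₁ a₂ ((((BFI.dyadic N).filter (fun n : ℕ => IsCoprime (n : ℤ) a₂)).filter (fun n : ℕ => n₀ ∣ n)).image (fun n : ℕ => n / n₀)) q₀ n₀ l₁ l₂ β ξ H 1 (2 ^ k) (2 ^ (k + 1)) δ₁ δ₂) n r s‖ ^ 2)) := by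
  have hm : 0 < a₂.natAbs * n₀ := Nat.mul_pos (Int.natAbs_pos.2 ha₂) hn₀
  haveI : NeZero (a₂.natAbs * n₀) := ⟨hm.ne'⟩
  -- the classes `c₀ = λ₂ δ₂⁻¹`, `d₀ = λ₁ δ₁⁻¹`
  have hδ₂u : IsUnit ((δ₂ : ℕ) : ZMod (a₂.natAbs * n₀)) := (ZMod.isUnit_iff_coprime _ _).2 hδ₂m
  have hδ₁u : IsUnit ((δ₁ : ℕ) : ZMod (a₂.natAbs * n₀)) := (ZMod.isUnit_iff_coprime _ _).2 hδ₁m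
  have hl₂u : IsUnit ((l₂ : ℕ) : ZMod (a₂.natAbs * n₀)) := (ZMod.isUnit_iff_coprime _ _).2 hl₂
  have hl₁u : IsUnit ((l₁ : ℕ) : ZMod (a₂.natAbs * n₀)) := (ZMod.isUnit_iff_coprime _ _).2 hl₁
  set c₀ : ℕ := (((l₂ : ℕ) : ZMod (a₂.natAbs * n₀)) * (((δ₂ : ℕ) : ZMod (a₂.natAbs * n₀)))⁻¹).val
    with hc₀def
  set d₀ : ℕ := (((l₁ : ℕ) : ZMod (a₂.natAbs * n₀)) * (((δ₁ : ℕ) : ZMod (a₂.natAbs * n₀)))⁻¹).val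
    with hd₀def
  have hc₀ : δ₂ * c₀ ≡ l₂ [MOD a₂.natAbs * n₀] := by
    rw [← ZMod.natCast_eq_natCast_iff, Nat.cast_mul, hc₀def, ZMod.natCast_zmod_val, mul_left_comm,
      ZMod.mul_inv_of_unit _ hδ₂u, mul_one]
  have hd₀ : δ₁ * d₀ ≡ l₁ [MOD a₂.natAbs * n₀] := by
    rw [← ZMod.natCast_eq_natCast_iff, Nat.cast_mul, hd₀def, ZMod.natCast_zmod_val, mul_left_comm,
      ZMod.mul_inv_of_unit _ hδ₁u, mul_one]
  have hcop : Nat.Coprime (c₀ * d₀) (a₂.natAbs * n₀) := by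
    refine Nat.Coprime.mul_left ?_ ?_
    · rw [← ZMod.isUnit_iff_coprime, hc₀def, ZMod.natCast_zmod_val]
      exact hl₂u.mul (IsUnit.of_mul_eq_one _ (ZMod.inv_mul_of_unit _ hδ₂u))
    · rw [← ZMod.isUnit_iff_coprime, hd₀def, ZMod.natCast_zmod_val]
      exact hl₁u.mul (IsUnit.of_mul_eq_one _ (ZMod.inv_mul_of_unit _ hδ₁u))
  -- the weight
  obtain ⟨hgcd, hghc, hgsup, hgder⟩ := drWeight_cruxHyps_LH hY hYS hq₀ hδ₁ hδ₂
    (κ := (q₀ : ℝ) * ξ / M * δ₁ * δ₂) (R := (a₂.natAbs : ℝ) * δ₁ * N) (S' := (δ₂ : ℝ) * N / n₀)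
    (by positivity) hR1 hS1 k hε₀ hε₀1 hΛ hΛt
  -- ranges
  have hIn : ∀ z : ℤ, (((2 ^ k : ℕ) : ℕ) : ℤ) ≤ z → z < (((2 ^ (k + 1) : ℕ) : ℕ) : ℤ) →
      z.toNat ∈ Finset.Icc 1 ⌊((2 ^ (k + 1) : ℕ) : ℝ)⌋₊ := by
    intro z h1 h2
    rw [Nat.floor_natCast, Finset.mem_Icc]
    have hk1 : 1 ≤ 2 ^ k := Nat.one_le_two_pow
    generalize (2 ^ k : ℕ) = u at h1 hk1
    generalize (2 ^ (k + 1) : ℕ) = v at h2 ⊢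
    constructor <;> omega
  have hIr : ∀ n₂ ∈ ((((BFI.dyadic N).filter (fun n : ℕ => IsCoprime (n : ℤ) a₂)).filter (fun n : ℕ => n₀ ∣ n)).image (fun n : ℕ => n / n₀)), a₂.natAbs * n₀ * δ₁ * n₂ ∈ Finset.Icc 1 ⌊2 * ((a₂.natAbs : ℝ) * δ₁ * N)⌋₊ := by
    intro n₂ hn₂
    obtain ⟨hpos, -, hdy⟩ := mem_Bset hN.le hn₀ hn₂
    have h2 := ((BFI.mem_dyadic hN.le).1 hdy).2
    rw [Finset.mem_Icc]
    refine ⟨Nat.one_le_iff_ne_zero.2 (Nat.pos_iff_ne_zero.1 (by positivity)), Nat.le_floor ?_⟩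
    push_cast at h2 ⊢
    have h0 : (0 : ℝ) ≤ (a₂.natAbs : ℝ) * δ₁ := by positivity
    calc (a₂.natAbs : ℝ) * n₀ * δ₁ * n₂ = (a₂.natAbs : ℝ) * δ₁ * ((n₀ : ℝ) * n₂) := by ring
      _ ≤ (a₂.natAbs : ℝ) * δ₁ * (2 * N) := mul_le_mul_of_nonneg_left h2 h0
      _ = 2 * ((a₂.natAbs : ℝ) * δ₁ * N) := by ring
  have hIs : ∀ n₁ ∈ ((((BFI.dyadic N).filter (fun n : ℕ => IsCoprime (n : ℤ) a₂)).filter (fun n : ℕ => n₀ ∣ n)).image (fun n : ℕ => n / n₀)), δ₂ * n₁ ∈ Finset.Icc 1 ⌊2 * ((δ₂ : ℝ) * N / n₀)⌋₊ := by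
    intro n₁ hn₁
    obtain ⟨hpos, -, hdy⟩ := mem_Bset hN.le hn₀ hn₁
    have h2 := ((BFI.mem_dyadic hN.le).1 hdy).2
    rw [Finset.mem_Icc]
    refine ⟨Nat.one_le_iff_ne_zero.2 (Nat.pos_iff_ne_zero.1 (by positivity)), Nat.le_floor ?_⟩
    have hn₀r : (0 : ℝ) < n₀ := by exact_mod_cast hn₀
    rw [show 2 * ((δ₂ : ℝ) * N / n₀) = (δ₂ : ℝ) * (2 * N) / n₀ by ring, le_div_iff₀ hn₀r]
    push_cast at h2 ⊢
    have h0 : (0 : ℝ) ≤ (δ₂ : ℝ) := by positivity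
    calc (δ₂ : ℝ) * n₁ * n₀ = (δ₂ : ℝ) * ((n₀ : ℝ) * n₁) := by ring
      _ ≤ (δ₂ : ℝ) * (2 * N) := mul_le_mul_of_nonneg_left h2 h0
  have h1N : (1 : ℝ) ≤ ((2 ^ (k + 1) : ℕ) : ℝ) := by exact_mod_cast Nat.one_le_two_pow
  -- the identity with the left-hand side of Theorem 2.1
  rw [pieceSumBlk_eq_cruxLHS_pos hN.le ha₂ hq₀ hn₀ hq₀n₀ hq₀a₂ hl₁ hl₂ hl₁lt hl₂lt hδ₁ hδ₂ hδ₁m hδ₂m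
    hc₀ hd₀ hβ ξ H (2 ^ k) (2 ^ (k + 1)) ⌊2 * (9 / 8 * S / ((q₀ : ℝ) * δ₂))⌋₊ ⌊2 * (29 / 40 * S / ((q₀ : ℝ) * δ₁))⌋₊ hIn hIr hIs
    (G := (fun q₁ q₂ : ℕ => pieceLo S Y q₀ q₁ * pieceHi S Y q₀ q₂ *
          alphaProfile ((q₀ : ℝ) * ξ / M * q₁ * q₂)))
    (g := (drWeight (pieceHi S Y ((q₀ : ℝ) * δ₂)) (pieceLo S Y ((q₀ : ℝ) * δ₁))
          ((q₀ : ℝ) * ξ / M * δ₁ * δ₂) ((2 : ℝ) ^ k) ((a₂.natAbs : ℝ) * δ₁ * N) ((δ₂ : ℝ) * N / n₀)))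
    (fun c d n r s h => drWeight_support_LH hY hYS hN ha₂ hq₀ hn₀ hδ₁ hδ₂ k c d n r s h)
    (fun c d n₁ hn₁ n₂ hn₂ h hlo hhi => G_eq_drWeight_LH hN ha₂ hn₀ hδ₁ hδ₂ 1
      (mem_Bset hN.le hn₀ hn₁).2.2 (mem_Bset hN.le hn₀ hn₂).2.2 h hlo hhi)]
  have hbsupp : ∀ n r s : ℕ, (bCoef a₁ a₂ ((((BFI.dyadic N).filter (fun n : ℕ => IsCoprime (n : ℤ) a₂)).filter (fun n : ℕ => n₀ ∣ n)).image (fun n : ℕ => n / n₀)) q₀ n₀ l₁ l₂ β ξ H 1 (2 ^ k) (2 ^ (k + 1)) δ₁ δ₂) n r s ≠ 0 →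
      (0 < n ∧ (n : ℝ) ≤ ((2 ^ (k + 1) : ℕ) : ℝ) ∧ ((a₂.natAbs : ℝ) * δ₁ * N) < r ∧
        (r : ℝ) ≤ 2 * ((a₂.natAbs : ℝ) * δ₁ * N) ∧ ((δ₂ : ℝ) * N / n₀) < s ∧
        (s : ℝ) ≤ 2 * ((δ₂ : ℝ) * N / n₀)) := by
    intro n r s hb
    rw [bCoef_eq_bGen] at hb
    exact bGen_support hN.le ha₂ hn₀ hδ₁ hδ₂ Nat.one_le_two_pow H _ hb
  exact hcrux (9 / 8 * S / ((q₀ : ℝ) * δ₂)) (29 / 40 * S / ((q₀ : ℝ) * δ₁)) ((2 ^ (k + 1) : ℕ) : ℝ) ((a₂.natAbs : ℝ) * δ₁ * N) ((δ₂ : ℝ) * N / n₀)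
    hC1 hD1 h1N hR1 hS1 (a₂.natAbs * n₀) c₀ d₀ hm hcop
    (bCoef a₁ a₂ ((((BFI.dyadic N).filter (fun n : ℕ => IsCoprime (n : ℤ) a₂)).filter (fun n : ℕ => n₀ ∣ n)).image (fun n : ℕ => n / n₀)) q₀ n₀ l₁ l₂ β ξ H 1 (2 ^ k) (2 ^ (k + 1)) δ₁ δ₂) hbsupp
    (drWeight (pieceHi S Y ((q₀ : ℝ) * δ₂)) (pieceLo S Y ((q₀ : ℝ) * δ₁))
          ((q₀ : ℝ) * ξ / M * δ₁ * δ₂) ((2 : ℝ) ^ k) ((a₂.natAbs : ℝ) * δ₁ * N) ((δ₂ : ℝ) * N / n₀)) hgcd hghc hgsup hgder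

/-- **A blocked piece of `ℛ₁''` (pieces `LH`, negative block) is bounded by the right-hand side of
Theorem 2.1** (`𝐪 = |a₂|n₀`, `C = C_j`, `D = C_i`, `𝐍 = 2^{k+1}`, `R = |a₂|δ₁N`, `𝐒 = δ₂N/n₀`).
[cite: Drappeau2017, §5.5 p. 21, (5.24)] -/
theorem blk_le_crux_LH_neg {S Y N M ξ : ℝ} (hY : 0 < Y) (hYS : Y ≤ S / 4) (hN : 0 < N)
    (hM : 0 ≤ M) (hξ : 0 ≤ ξ) {a₁ a₂ : ℤ} (ha₂ : a₂ ≠ 0) {q₀ n₀ : ℕ} (hq₀ : 0 < q₀) (hn₀ : 0 < n₀)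
    (hq₀n₀ : Nat.Coprime q₀ n₀) (hq₀a₂ : IsCoprime (q₀ : ℤ) a₂)
    {l₁ l₂ : ℕ} (hl₁ : Nat.Coprime l₁ (a₂.natAbs * n₀)) (hl₂ : Nat.Coprime l₂ (a₂.natAbs * n₀))
    (hl₁lt : l₁ < a₂.natAbs * n₀) (hl₂lt : l₂ < a₂.natAbs * n₀)
    {δ₁ δ₂ : ℕ} (hδ₁ : 0 < δ₁) (hδ₂ : 0 < δ₂) (hδ₁m : Nat.Coprime δ₁ (a₂.natAbs * n₀))
    (hδ₂m : Nat.Coprime δ₂ (a₂.natAbs * n₀))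
    {β : ℕ → ℂ} (hβ : ∀ n, ¬Squarefree n → β n = 0) (H k : ℕ)
    (hC1 : (1 : ℝ) ≤ (9 / 8 * S / ((q₀ : ℝ) * δ₂))) (hD1 : (1 : ℝ) ≤ (29 / 40 * S / ((q₀ : ℝ) * δ₁)))
    (hR1 : (1 : ℝ) ≤ (a₂.natAbs : ℝ) * δ₁ * N) (hS1 : (1 : ℝ) ≤ (δ₂ : ℝ) * N / n₀)
    {ε₀ Λ : ℝ} (hε₀ : 0 ≤ ε₀) (hε₀1 : ε₀ ≤ 1) (hΛ : 0 ≤ Λ)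
    (hΛt : ∀ t : ℝ, (S - Y) / ((q₀ : ℝ) * ((δ₁ : ℝ) * δ₂)) ≤ t →
      (2 * S + Y) / Y + 29 + 3 ≤ Λ * t ^ ε₀)
    {A e : ℝ}
    (hcrux : (∀ C D N R S : ℝ, 1 ≤ C → 1 ≤ D → 1 ≤ N → 1 ≤ R → 1 ≤ S →
      ∀ q c₀ d₀ : ℕ, 0 < q → Nat.Coprime (c₀ * d₀) q →
      ∀ b : ℕ → ℕ → ℕ → ℂ,
        (∀ n r s : ℕ, b n r s ≠ 0 →
          (0 < n ∧ (n : ℝ) ≤ N ∧ R < r ∧ (r : ℝ) ≤ 2 * R ∧ S < s ∧ (s : ℝ) ≤ 2 * S)) →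
      ∀ g : ℝ → ℝ → ℝ → ℝ → ℝ → ℂ,
        ContDiff ℝ (⊤ : ℕ∞) (fun p : Fin 5 → ℝ => g (p 0) (p 1) (p 2) (p 3) (p 4)) →
        HasCompactSupport (fun p : Fin 5 → ℝ => g (p 0) (p 1) (p 2) (p 3) (p 4)) →
        (∀ c d n r s : ℝ, g c d n r s ≠ 0 →
          (C < c ∧ c ≤ 2 * C ∧ D < d ∧ d ≤ 2 * D ∧ 0 < n ∧ 0 < r ∧ 0 < s)) →
        (∀ ν : Fin 5 → ℕ, ∀ c d n r s : ℝ, 0 < c → 0 < d → 0 < n → 0 < r → 0 < s →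
          ‖mixedDeriv ν g c d n r s‖ ≤ KnuFamily Λ ν *
            (c ^ (-(ν 0 : ℝ)) * d ^ (-(ν 1 : ℝ)) * n ^ (-(ν 2 : ℝ)) * r ^ (-(ν 3 : ℝ)) *
              s ^ (-(ν 4 : ℝ))) ^ (1 - ε₀)) →
        ‖∑ c ∈ Finset.Icc 1 ⌊2 * C⌋₊, ∑ d ∈ Finset.Icc 1 ⌊2 * D⌋₊, ∑ n ∈ Finset.Icc 1 ⌊N⌋₊, ∑ r ∈ Finset.Icc 1 ⌊2 * R⌋₊,
            ∑ s ∈ Finset.Icc 1 ⌊2 * S⌋₊,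
            (if (c ≡ c₀ [MOD q] ∧ d ≡ d₀ [MOD q] ∧ Nat.Coprime (q * r * d) (s * c)) then
              b n r s * g c d n r s *
                (𝐞 ((n : ℝ) * ((((r * d : ℕ) : ZMod (s * c))⁻¹).val : ℝ) / ((s : ℝ) * c)) : ℂ)
            else 0)‖ ≤
          A * ((q : ℝ) * C * D * N * R * S) ^ e * (q : ℝ) ^ (3 / 2 : ℝ) *
            Real.sqrt
              ((q : ℝ) ^ 2 * (C * S * (R * S + N) * (C + R * D) + S * N * R) *
                  (∑ n ∈ Finset.Icc 1 ⌊N⌋₊, ∑ r ∈ Finset.Icc 1 ⌊2 * R⌋₊, ∑ s ∈ Finset.Icc 1 ⌊2 * S⌋₊, ‖b n r s‖ ^ 2) +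
                (q : ℝ) * (C ^ 2 * D * S * Real.sqrt (R * (R * S + N)) + D ^ 2 * N * R) *
                  (∑ n ∈ Finset.Icc 1 ⌊N⌋₊, ∑ r ∈ Finset.Icc 1 ⌊2 * R⌋₊, ∑ s ∈ Finset.Icc 1 ⌊2 * S⌋₊, ‖b n r s‖ ^ 2)))) :
    ‖pieceSumBlk a₁ a₂ (((((((BFI.mRange S Y).filter (fun q : ℕ => 0 < q)).filter (fun q : ℕ => IsCoprime (q : ℤ) a₂)).filter (fun q : ℕ => q₀ ∣ q)).image (fun q : ℕ => q / q₀)).filter (fun q : ℕ => q % (a₂.natAbs * n₀) = l₁)).filter (fun q : ℕ => δ₁ ∣ q))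
        (((((((BFI.mRange S Y).filter (fun q : ℕ => 0 < q)).filter (fun q : ℕ => IsCoprime (q : ℤ) a₂)).filter (fun q : ℕ => q₀ ∣ q)).image (fun q : ℕ => q / q₀)).filter (fun q : ℕ => q % (a₂.natAbs * n₀) = l₂)).filter (fun q : ℕ => δ₂ ∣ q)) ((((BFI.dyadic N).filter (fun n : ℕ => IsCoprime (n : ℤ) a₂)).filter (fun n : ℕ => n₀ ∣ n)).image (fun n : ℕ => n / n₀))
        q₀ n₀ l₁ l₂ β ξ (fun q₁ q₂ : ℕ => pieceLo S Y q₀ q₁ * pieceHi S Y q₀ q₂ *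
          alphaProfile ((q₀ : ℝ) * ξ / M * q₁ * q₂)) H (-1) (2 ^ k) (2 ^ (k + 1))‖ ≤
      A * (((a₂.natAbs * n₀ : ℕ) : ℝ) * (9 / 8 * S / ((q₀ : ℝ) * δ₂)) * (29 / 40 * S / ((q₀ : ℝ) * δ₁)) * ((2 ^ (k + 1) : ℕ) : ℝ) * ((a₂.natAbs : ℝ) * δ₁ * N) * ((δ₂ : ℝ) * N / n₀)) ^ e * ((a₂.natAbs * n₀ : ℕ) : ℝ) ^ (3 / 2 : ℝ) *
        Real.sqrt (((a₂.natAbs * n₀ : ℕ) : ℝ) ^ 2 * ((9 / 8 * S / ((q₀ : ℝ) * δ₂)) * ((δ₂ : ℝ) * N / n₀) * (((a₂.natAbs : ℝ) * δ₁ * N) * ((δ₂ : ℝ) * N / n₀) + ((2 ^ (k + 1) : ℕ) : ℝ)) * ((9 / 8 * S / ((q₀ : ℝ) * δ₂)) + ((a₂.natAbs : ℝ) * δ₁ * N) * (29 / 40 * S / ((q₀ : ℝ) * δ₁))) + ((δ₂ : ℝ) * N / n₀) * ((2 ^ (k + 1) : ℕ) : ℝ) * ((a₂.natAbs : ℝ)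 * δ₁ * N)) *
              (∑ n ∈ Finset.Icc 1 ⌊((2 ^ (k + 1) : ℕ) : ℝ)⌋₊, ∑ r ∈ Finset.Icc 1 ⌊2 * ((a₂.natAbs : ℝ) * δ₁ * N)⌋₊, ∑ s ∈ Finset.Icc 1 ⌊2 * ((δ₂ : ℝ) * N / n₀)⌋₊, ‖(bGen a₁ a₂ ((((BFI.dyadic N).filter (fun n : ℕ => IsCoprime (n : ℤ) a₂)).filter (fun n : ℕ => n₀ ∣ n)).image (fun n : ℕ => n / n₀)) q₀ n₀ H (-1) (2 ^ k) (2 ^ (k + 1)) δ₁ δ₂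
            (fun h n₁ n₂ => starRingEnd ℂ (β (n₀ * n₁) * starRingEnd ℂ (β (n₀ * n₂)) *
              ((𝐞 (-(ξ * h)) : ℂ) *
                (𝐞 (-((h : ℝ) * a₁ *
                    ((((((q₀ : ℤ) * l₁ * l₂ * n₁ : ℤ) : ZMod (a₂.natAbs * n₀))⁻¹).val : ℕ) : ℝ) /
                      ((a₂ : ℝ) * n₀))) : ℂ))))) n r s‖ ^ 2) +
            ((a₂.natAbs * n₀ : ℕ) : ℝ) * ((9 / 8 * S / ((q₀ : ℝ) * δ₂)) ^ 2 * (29 / 40 * S / ((q₀ : ℝ) * δ₁)) * ((δ₂ : ℝ) * N / n₀) * Real.sqrt (((a₂.natAbs : ℝ) * δ₁ * N) * (((a₂.natAbs : ℝ) * δ₁ * N) * ((δ₂ : ℝ) * N / n₀) + ((2 ^ (k + 1) : ℕ) : ℝ))) + (29 / 40 * S / ((q₀ : ℝ) * δ₁)) ^ 2 * ((2 ^ (k + 1) : ℕ) : ℝ) * ((a₂.natAbs : ℝ) * δ₁ * N)) *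
              (∑ n ∈ Finset.Icc 1 ⌊((2 ^ (k + 1) : ℕ) : ℝ)⌋₊, ∑ r ∈ Finset.Icc 1 ⌊2 * ((a₂.natAbs : ℝ) * δ₁ * N)⌋₊, ∑ s ∈ Finset.Icc 1 ⌊2 * ((δ₂ : ℝ) * N / n₀)⌋₊, ‖(bGen a₁ a₂ ((((BFI.dyadic N).filter (fun n : ℕ => IsCoprime (n : ℤ) a₂)).filter (fun n : ℕ => n₀ ∣ n)).image (fun n : ℕ => n / n₀)) q₀ n₀ H (-1) (2 ^ k) (2 ^ (k + 1)) δ₁ δ₂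
            (fun h n₁ n₂ => starRingEnd ℂ (β (n₀ * n₁) * starRingEnd ℂ (β (n₀ * n₂)) *
              ((𝐞 (-(ξ * h)) : ℂ) *
                (𝐞 (-((h : ℝ) * a₁ *
                    ((((((q₀ : ℤ) * l₁ * l₂ * n₁ : ℤ) : ZMod (a₂.natAbs * n₀))⁻¹).val : ℕ) : ℝ) /
                      ((a₂ : ℝ) * n₀))) : ℂ))))) n r s‖ ^ 2)) := by
  have hm : 0 < a₂.natAbs * n₀ := Nat.mul_pos (Int.natAbs_pos.2 ha₂) hn₀
  haveI : NeZero (a₂.natAbs * n₀) := ⟨hm.ne'⟩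
  -- the classes `c₀ = λ₂ δ₂⁻¹`, `d₀ = λ₁ δ₁⁻¹`
  have hδ₂u : IsUnit ((δ₂ : ℕ) : ZMod (a₂.natAbs * n₀)) := (ZMod.isUnit_iff_coprime _ _).2 hδ₂m
  have hδ₁u : IsUnit ((δ₁ : ℕ) : ZMod (a₂.natAbs * n₀)) := (ZMod.isUnit_iff_coprime _ _).2 hδ₁m
  have hl₂u : IsUnit ((l₂ : ℕ) : ZMod (a₂.natAbs * n₀)) := (ZMod.isUnit_iff_coprime _ _).2 hl₂
  have hl₁u : IsUnit ((l₁ : ℕ) : ZMod (a₂.natAbs * n₀)) := (ZMod.isUnit_iff_coprime _ _).2 hl₁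
  set c₀ : ℕ := (((l₂ : ℕ) : ZMod (a₂.natAbs * n₀)) * (((δ₂ : ℕ) : ZMod (a₂.natAbs * n₀)))⁻¹).val
    with hc₀def
  set d₀ : ℕ := (((l₁ : ℕ) : ZMod (a₂.natAbs * n₀)) * (((δ₁ : ℕ) : ZMod (a₂.natAbs * n₀)))⁻¹).val
    with hd₀def
  have hc₀ : δ₂ * c₀ ≡ l₂ [MOD a₂.natAbs * n₀] := by
    rw [← ZMod.natCast_eq_natCast_iff, Nat.cast_mul, hc₀def, ZMod.natCast_zmod_val, mul_left_comm,
      ZMod.mul_inv_of_unit _ hδ₂u, mul_one]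
  have hd₀ : δ₁ * d₀ ≡ l₁ [MOD a₂.natAbs * n₀] := by
    rw [← ZMod.natCast_eq_natCast_iff, Nat.cast_mul, hd₀def, ZMod.natCast_zmod_val, mul_left_comm,
      ZMod.mul_inv_of_unit _ hδ₁u, mul_one]
  have hcop : Nat.Coprime (c₀ * d₀) (a₂.natAbs * n₀) := by
    refine Nat.Coprime.mul_left ?_ ?_
    · rw [← ZMod.isUnit_iff_coprime, hc₀def, ZMod.natCast_zmod_val]
      exact hl₂u.mul (IsUnit.of_mul_eq_one _ (ZMod.inv_mul_of_unit _ hδ₂u))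
    · rw [← ZMod.isUnit_iff_coprime, hd₀def, ZMod.natCast_zmod_val]
      exact hl₁u.mul (IsUnit.of_mul_eq_one _ (ZMod.inv_mul_of_unit _ hδ₁u))
  -- the weight
  obtain ⟨hgcd, hghc, hgsup, hgder⟩ := drWeight_cruxHyps_LH hY hYS hq₀ hδ₁ hδ₂
    (κ := (q₀ : ℝ) * ξ / M * δ₁ * δ₂) (R := (a₂.natAbs : ℝ) * δ₁ * N) (S' := (δ₂ : ℝ) * N / n₀)
    (by positivity) hR1 hS1 k hε₀ hε₀1 hΛ hΛt
  -- ranges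
  have hIn : ∀ z : ℤ, (((2 ^ k : ℕ) : ℕ) : ℤ) ≤ z → z < (((2 ^ (k + 1) : ℕ) : ℕ) : ℤ) →
      z.toNat ∈ Finset.Icc 1 ⌊((2 ^ (k + 1) : ℕ) : ℝ)⌋₊ := by
    intro z h1 h2
    rw [Nat.floor_natCast, Finset.mem_Icc]
    have hk1 : 1 ≤ 2 ^ k := Nat.one_le_two_pow
    generalize (2 ^ k : ℕ) = u at h1 hk1
    generalize (2 ^ (k + 1) : ℕ) = v at h2 ⊢
    constructor <;> omega
  have hIr : ∀ n₂ ∈ ((((BFI.dyadic N).filter (fun n : ℕ => IsCoprime (n : ℤ) a₂)).filter (fun n : ℕ => n₀ ∣ n)).image (fun n : ℕ => n / n₀)), a₂.natAbs * n₀ * δ₁ * n₂ ∈ Finset.Icc 1 ⌊2 * ((a₂.natAbs : ℝ) * δ₁ * N)⌋₊ := by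
    intro n₂ hn₂
    obtain ⟨hpos, -, hdy⟩ := mem_Bset hN.le hn₀ hn₂
    have h2 := ((BFI.mem_dyadic hN.le).1 hdy).2
    rw [Finset.mem_Icc]
    refine ⟨Nat.one_le_iff_ne_zero.2 (Nat.pos_iff_ne_zero.1 (by positivity)), Nat.le_floor ?_⟩
    push_cast at h2 ⊢
    have h0 : (0 : ℝ) ≤ (a₂.natAbs : ℝ) * δ₁ := by positivity
    calc (a₂.natAbs : ℝ) * n₀ * δ₁ * n₂ = (a₂.natAbs : ℝ) * δ₁ * ((n₀ : ℝ) * n₂) := by ring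
      _ ≤ (a₂.natAbs : ℝ) * δ₁ * (2 * N) := mul_le_mul_of_nonneg_left h2 h0
      _ = 2 * ((a₂.natAbs : ℝ) * δ₁ * N) := by ring
  have hIs : ∀ n₁ ∈ ((((BFI.dyadic N).filter (fun n : ℕ => IsCoprime (n : ℤ) a₂)).filter (fun n : ℕ => n₀ ∣ n)).image (fun n : ℕ => n / n₀)), δ₂ * n₁ ∈ Finset.Icc 1 ⌊2 * ((δ₂ : ℝ) * N / n₀)⌋₊ := by
    intro n₁ hn₁
    obtain ⟨hpos, -, hdy⟩ := mem_Bset hN.le hn₀ hn₁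
    have h2 := ((BFI.mem_dyadic hN.le).1 hdy).2
    rw [Finset.mem_Icc]
    refine ⟨Nat.one_le_iff_ne_zero.2 (Nat.pos_iff_ne_zero.1 (by positivity)), Nat.le_floor ?_⟩
    have hn₀r : (0 : ℝ) < n₀ := by exact_mod_cast hn₀
    rw [show 2 * ((δ₂ : ℝ) * N / n₀) = (δ₂ : ℝ) * (2 * N) / n₀ by ring, le_div_iff₀ hn₀r]
    push_cast at h2 ⊢
    have h0 : (0 : ℝ) ≤ (δ₂ : ℝ) := by positivity
    calc (δ₂ : ℝ) * n₁ * n₀ = (δ₂ : ℝ) * ((n₀ : ℝ) * n₁) := by ring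
      _ ≤ (δ₂ : ℝ) * (2 * N) := mul_le_mul_of_nonneg_left h2 h0
  have h1N : (1 : ℝ) ≤ ((2 ^ (k + 1) : ℕ) : ℝ) := by exact_mod_cast Nat.one_le_two_pow
  -- conjugate, then the identity with the left-hand side of Theorem 2.1
  rw [← Complex.norm_conj (pieceSumBlk a₁ a₂ (((((((BFI.mRange S Y).filter (fun q : ℕ => 0 < q)).filter (fun q : ℕ => IsCoprime (q : ℤ) a₂)).filter (fun q : ℕ => q₀ ∣ q)).image (fun q : ℕ => q / q₀)).filter (fun q : ℕ => q % (a₂.natAbs * n₀) = l₁)).filter (fun q : ℕ => δ₁ ∣ q))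
        (((((((BFI.mRange S Y).filter (fun q : ℕ => 0 < q)).filter (fun q : ℕ => IsCoprime (q : ℤ) a₂)).filter (fun q : ℕ => q₀ ∣ q)).image (fun q : ℕ => q / q₀)).filter (fun q : ℕ => q % (a₂.natAbs * n₀) = l₂)).filter (fun q : ℕ => δ₂ ∣ q)) ((((BFI.dyadic N).filter (fun n : ℕ => IsCoprime (n : ℤ) a₂)).filter (fun n : ℕ => n₀ ∣ n)).image (fun n : ℕ => n / n₀))
        q₀ n₀ l₁ l₂ β ξ (fun q₁ q₂ : ℕ => pieceLo S Y q₀ q₁ * pieceHi S Y q₀ q₂ *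
          alphaProfile ((q₀ : ℝ) * ξ / M * q₁ * q₂)) H (-1) (2 ^ k) (2 ^ (k + 1)))]
  rw [conj_pieceSumBlk_eq_cruxLHS_neg hN.le ha₂ hq₀ hn₀ hq₀n₀ hq₀a₂ hl₁ hl₂ hl₁lt hl₂lt hδ₁ hδ₂ hδ₁m hδ₂m
    hc₀ hd₀ hβ ξ H (2 ^ k) (2 ^ (k + 1)) ⌊2 * (9 / 8 * S / ((q₀ : ℝ) * δ₂))⌋₊ ⌊2 * (29 / 40 * S / ((q₀ : ℝ) * δ₁))⌋₊ hIn hIr hIs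
    (G := (fun q₁ q₂ : ℕ => pieceLo S Y q₀ q₁ * pieceHi S Y q₀ q₂ *
          alphaProfile ((q₀ : ℝ) * ξ / M * q₁ * q₂)))
    (g := (drWeight (pieceHi S Y ((q₀ : ℝ) * δ₂)) (pieceLo S Y ((q₀ : ℝ) * δ₁))
          ((q₀ : ℝ) * ξ / M * δ₁ * δ₂) ((2 : ℝ) ^ k) ((a₂.natAbs : ℝ) * δ₁ * N) ((δ₂ : ℝ) * N / n₀)))
    (fun c d n r s h => drWeight_support_LH hY hYS hN ha₂ hq₀ hn₀ hδ₁ hδ₂ k c d n r s h)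
    (conj_G_LH S Y ξ M q₀)
    (fun c d n₁ hn₁ n₂ hn₂ h hlo hhi => G_eq_drWeight_LH hN ha₂ hn₀ hδ₁ hδ₂ (-1)
      (mem_Bset hN.le hn₀ hn₁).2.2 (mem_Bset hN.le hn₀ hn₂).2.2 h hlo hhi)]
  have hbsupp : ∀ n r s : ℕ, (bGen a₁ a₂ ((((BFI.dyadic N).filter (fun n : ℕ => IsCoprime (n : ℤ) a₂)).filter (fun n : ℕ => n₀ ∣ n)).image (fun n : ℕ => n / n₀)) q₀ n₀ H (-1) (2 ^ k) (2 ^ (k + 1)) δ₁ δ₂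
            (fun h n₁ n₂ => starRingEnd ℂ (β (n₀ * n₁) * starRingEnd ℂ (β (n₀ * n₂)) *
              ((𝐞 (-(ξ * h)) : ℂ) *
                (𝐞 (-((h : ℝ) * a₁ *
                    ((((((q₀ : ℤ) * l₁ * l₂ * n₁ : ℤ) : ZMod (a₂.natAbs * n₀))⁻¹).val : ℕ) : ℝ) /
                      ((a₂ : ℝ) * n₀))) : ℂ))))) n r s ≠ 0 →
      (0 < n ∧ (n : ℝ) ≤ ((2 ^ (k + 1) : ℕ) : ℝ) ∧ ((a₂.natAbs : ℝ) * δ₁ * N) < r ∧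
        (r : ℝ) ≤ 2 * ((a₂.natAbs : ℝ) * δ₁ * N) ∧ ((δ₂ : ℝ) * N / n₀) < s ∧
        (s : ℝ) ≤ 2 * ((δ₂ : ℝ) * N / n₀)) :=
    fun n r s hb => bGen_support hN.le ha₂ hn₀ hδ₁ hδ₂ Nat.one_le_two_pow H _ hb
  exact hcrux (9 / 8 * S / ((q₀ : ℝ) * δ₂)) (29 / 40 * S / ((q₀ : ℝ) * δ₁)) ((2 ^ (k + 1) : ℕ) : ℝ) ((a₂.natAbs : ℝ) * δ₁ * N) ((δ₂ : ℝ) * N / n₀)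
    hC1 hD1 h1N hR1 hS1 (a₂.natAbs * n₀) c₀ d₀ hm hcop
    (bGen a₁ a₂ ((((BFI.dyadic N).filter (fun n : ℕ => IsCoprime (n : ℤ) a₂)).filter (fun n : ℕ => n₀ ∣ n)).image (fun n : ℕ => n / n₀)) q₀ n₀ H (-1) (2 ^ k) (2 ^ (k + 1)) δ₁ δ₂
            (fun h n₁ n₂ => starRingEnd ℂ (β (n₀ * n₁) * starRingEnd ℂ (β (n₀ * n₂)) *
              ((𝐞 (-(ξ * h)) : ℂ) *
                (𝐞 (-((h : ℝ) * a₁ *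
                    ((((((q₀ : ℤ) * l₁ * l₂ * n₁ : ℤ) : ZMod (a₂.natAbs * n₀))⁻¹).val : ℕ) : ℝ) /
                      ((a₂ : ℝ) * n₀))) : ℂ))))) hbsupp
    (drWeight (pieceHi S Y ((q₀ : ℝ) * δ₂)) (pieceLo S Y ((q₀ : ℝ) * δ₁))
          ((q₀ : ℝ) * ξ / M * δ₁ * δ₂) ((2 : ℝ) ^ k) ((a₂.natAbs : ℝ) * δ₁ * N) ((δ₂ : ℝ) * N / n₀)) hgcd hghc hgsup hgder

/-- **A blocked piece of `ℛ₁''` (pieces `HL`, positive block) is bounded by the right-hand side of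
Theorem 2.1** (`𝐪 = |a₂|n₀`, `C = C_j`, `D = C_i`, `𝐍 = 2^{k+1}`, `R = |a₂|δ₁N`, `𝐒 = δ₂N/n₀`).
[cite: Drappeau2017, §5.5 p. 21, (5.24)] -/
theorem blk_le_crux_HL_pos {S Y N M ξ : ℝ} (hY : 0 < Y) (hYS : Y ≤ S / 4) (hN : 0 < N)
    (hM : 0 ≤ M) (hξ : 0 ≤ ξ) {a₁ a₂ : ℤ} (ha₂ : a₂ ≠ 0) {q₀ n₀ : ℕ} (hq₀ : 0 < q₀) (hn₀ : 0 < n₀)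
    (hq₀n₀ : Nat.Coprime q₀ n₀) (hq₀a₂ : IsCoprime (q₀ : ℤ) a₂)
    {l₁ l₂ : ℕ} (hl₁ : Nat.Coprime l₁ (a₂.natAbs * n₀)) (hl₂ : Nat.Coprime l₂ (a₂.natAbs * n₀))
    (hl₁lt : l₁ < a₂.natAbs * n₀) (hl₂lt : l₂ < a₂.natAbs * n₀)
    {δ₁ δ₂ : ℕ} (hδ₁ : 0 < δ₁) (hδ₂ : 0 < δ₂) (hδ₁m : Nat.Coprime δ₁ (a₂.natAbs * n₀))
    (hδ₂m : Nat.Coprime δ₂ (a₂.natAbs * n₀))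
    {β : ℕ → ℂ} (hβ : ∀ n, ¬Squarefree n → β n = 0) (H k : ℕ)
    (hC1 : (1 : ℝ) ≤ (29 / 40 * S / ((q₀ : ℝ) * δ₂))) (hD1 : (1 : ℝ) ≤ (9 / 8 * S / ((q₀ : ℝ) * δ₁)))
    (hR1 : (1 : ℝ) ≤ (a₂.natAbs : ℝ) * δ₁ * N) (hS1 : (1 : ℝ) ≤ (δ₂ : ℝ) * N / n₀)
    {ε₀ Λ : ℝ} (hε₀ : 0 ≤ ε₀) (hε₀1 : ε₀ ≤ 1) (hΛ : 0 ≤ Λ)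
    (hΛt : ∀ t : ℝ, (S - Y) / ((q₀ : ℝ) * ((δ₁ : ℝ) * δ₂)) ≤ t →
      (2 * S + Y) / Y + 29 + 3 ≤ Λ * t ^ ε₀)
    {A e : ℝ}
    (hcrux : (∀ C D N R S : ℝ, 1 ≤ C → 1 ≤ D → 1 ≤ N → 1 ≤ R → 1 ≤ S →
      ∀ q c₀ d₀ : ℕ, 0 < q → Nat.Coprime (c₀ * d₀) q →
      ∀ b : ℕ → ℕ → ℕ → ℂ,
        (∀ n r s : ℕ, b n r s ≠ 0 →
          (0 < n ∧ (n : ℝ) ≤ N ∧ R < r ∧ (r : ℝ) ≤ 2 * R ∧ S < s ∧ (s : ℝ) ≤ 2 * S)) →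
      ∀ g : ℝ → ℝ → ℝ → ℝ → ℝ → ℂ,
        ContDiff ℝ (⊤ : ℕ∞) (fun p : Fin 5 → ℝ => g (p 0) (p 1) (p 2) (p 3) (p 4)) →
        HasCompactSupport (fun p : Fin 5 → ℝ => g (p 0) (p 1) (p 2) (p 3) (p 4)) →
        (∀ c d n r s : ℝ, g c d n r s ≠ 0 →
          (C < c ∧ c ≤ 2 * C ∧ D < d ∧ d ≤ 2 * D ∧ 0 < n ∧ 0 < r ∧ 0 < s)) →
        (∀ ν : Fin 5 → ℕ, ∀ c d n r s : ℝ, 0 < c → 0 < d → 0 < n → 0 < r → 0 < s →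
          ‖mixedDeriv ν g c d n r s‖ ≤ KnuFamily Λ ν *
            (c ^ (-(ν 0 : ℝ)) * d ^ (-(ν 1 : ℝ)) * n ^ (-(ν 2 : ℝ)) * r ^ (-(ν 3 : ℝ)) *
              s ^ (-(ν 4 : ℝ))) ^ (1 - ε₀)) →
        ‖∑ c ∈ Finset.Icc 1 ⌊2 * C⌋₊, ∑ d ∈ Finset.Icc 1 ⌊2 * D⌋₊, ∑ n ∈ Finset.Icc 1 ⌊N⌋₊, ∑ r ∈ Finset.Icc 1 ⌊2 * R⌋₊,
            ∑ s ∈ Finset.Icc 1 ⌊2 * S⌋₊,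
            (if (c ≡ c₀ [MOD q] ∧ d ≡ d₀ [MOD q] ∧ Nat.Coprime (q * r * d) (s * c)) then
              b n r s * g c d n r s *
                (𝐞 ((n : ℝ) * ((((r * d : ℕ) : ZMod (s * c))⁻¹).val : ℝ) / ((s : ℝ) * c)) : ℂ)
            else 0)‖ ≤
          A * ((q : ℝ) * C * D * N * R * S) ^ e * (q : ℝ) ^ (3 / 2 : ℝ) *
            Real.sqrt
              ((q : ℝ) ^ 2 * (C * S * (R * S + N) * (C + R * D) + S * N * R) *
                  (∑ n ∈ Finset.Icc 1 ⌊N⌋₊, ∑ r ∈ Finset.Icc 1 ⌊2 * R⌋₊, ∑ s ∈ Finset.Icc 1 ⌊2 * S⌋₊, ‖b n r s‖ ^ 2) +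
                (q : ℝ) * (C ^ 2 * D * S * Real.sqrt (R * (R * S + N)) + D ^ 2 * N * R) *
                  (∑ n ∈ Finset.Icc 1 ⌊N⌋₊, ∑ r ∈ Finset.Icc 1 ⌊2 * R⌋₊, ∑ s ∈ Finset.Icc 1 ⌊2 * S⌋₊, ‖b n r s‖ ^ 2)))) :
    ‖pieceSumBlk a₁ a₂ (((((((BFI.mRange S Y).filter (fun q : ℕ => 0 < q)).filter (fun q : ℕ => IsCoprime (q : ℤ) a₂)).filter (fun q : ℕ => q₀ ∣ q)).image (fun q : ℕ => q / q₀)).filter (fun q : ℕ => q % (a₂.natAbs * n₀) = l₁)).filter (fun q : ℕ => δ₁ ∣ q))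
        (((((((BFI.mRange S Y).filter (fun q : ℕ => 0 < q)).filter (fun q : ℕ => IsCoprime (q : ℤ) a₂)).filter (fun q : ℕ => q₀ ∣ q)).image (fun q : ℕ => q / q₀)).filter (fun q : ℕ => q % (a₂.natAbs * n₀) = l₂)).filter (fun q : ℕ => δ₂ ∣ q)) ((((BFI.dyadic N).filter (fun n : ℕ => IsCoprime (n : ℤ) a₂)).filter (fun n : ℕ => n₀ ∣ n)).image (fun n : ℕ => n / n₀))
        q₀ n₀ l₁ l₂ β ξ (fun q₁ q₂ : ℕ => pieceHi S Y q₀ q₁ * pieceLo S Y q₀ q₂ *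
          alphaProfile ((q₀ : ℝ) * ξ / M * q₁ * q₂)) H 1 (2 ^ k) (2 ^ (k + 1))‖ ≤
      A * (((a₂.natAbs * n₀ : ℕ) : ℝ) * (29 / 40 * S / ((q₀ : ℝ) * δ₂)) * (9 / 8 * S / ((q₀ : ℝ) * δ₁)) * ((2 ^ (k + 1) : ℕ) : ℝ) * ((a₂.natAbs : ℝ) * δ₁ * N) * ((δ₂ : ℝ) * N / n₀)) ^ e * ((a₂.natAbs * n₀ : ℕ) : ℝ) ^ (3 / 2 : ℝ) *
        Real.sqrt (((a₂.natAbs * n₀ : ℕ) : ℝ) ^ 2 * ((29 / 40 * S / ((q₀ : ℝ) * δ₂)) * ((δ₂ : ℝ) * N / n₀) * (((a₂.natAbs : ℝ) * δ₁ * N) * ((δ₂ : ℝ) * N / n₀) + ((2 ^ (k + 1) : ℕ) : ℝ)) * ((29 / 40 * S / ((q₀ : ℝ) * δ₂)) + ((a₂.natAbs : ℝ) * δ₁ * N) * (9 / 8 * S / ((q₀ : ℝ) * δ₁))) + ((δ₂ : ℝ) * N / n₀) * ((2 ^ (k + 1) : ℕ) : ℝ) * ((a₂.natAbs : ℝ)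 * δ₁ * N)) *
              (∑ n ∈ Finset.Icc 1 ⌊((2 ^ (k + 1) : ℕ) : ℝ)⌋₊, ∑ r ∈ Finset.Icc 1 ⌊2 * ((a₂.natAbs : ℝ) * δ₁ * N)⌋₊, ∑ s ∈ Finset.Icc 1 ⌊2 * ((δ₂ : ℝ) * N / n₀)⌋₊, ‖(bCoef a₁ a₂ ((((BFI.dyadic N).filter (fun n : ℕ => IsCoprime (n : ℤ) a₂)).filter (fun n : ℕ => n₀ ∣ n)).image (fun n : ℕ => n / n₀)) q₀ n₀ l₁ l₂ β ξ H 1 (2 ^ k) (2 ^ (k + 1)) δ₁ δ₂) n r s‖ ^ 2) +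
            ((a₂.natAbs * n₀ : ℕ) : ℝ) * ((29 / 40 * S / ((q₀ : ℝ) * δ₂)) ^ 2 * (9 / 8 * S / ((q₀ : ℝ) * δ₁)) * ((δ₂ : ℝ) * N / n₀) * Real.sqrt (((a₂.natAbs : ℝ) * δ₁ * N) * (((a₂.natAbs : ℝ) * δ₁ * N) * ((δ₂ : ℝ) * N / n₀) + ((2 ^ (k + 1) : ℕ) : ℝ))) + (9 / 8 * S / ((q₀ : ℝ) * δ₁)) ^ 2 * ((2 ^ (k + 1) : ℕ) : ℝ) * ((a₂.natAbs : ℝ) * δ₁ * N)) *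
              (∑ n ∈ Finset.Icc 1 ⌊((2 ^ (k + 1) : ℕ) : ℝ)⌋₊, ∑ r ∈ Finset.Icc 1 ⌊2 * ((a₂.natAbs : ℝ) * δ₁ * N)⌋₊, ∑ s ∈ Finset.Icc 1 ⌊2 * ((δ₂ : ℝ) * N / n₀)⌋₊, ‖(bCoef a₁ a₂ ((((BFI.dyadic N).filter (fun n : ℕ => IsCoprime (n : ℤ) a₂)).filter (fun n : ℕ => n₀ ∣ n)).image (fun n : ℕ => n / n₀)) q₀ n₀ l₁ l₂ β ξ H 1 (2 ^ k) (2 ^ (k + 1)) δ₁ δ₂) n r s‖ ^ 2)) := by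
  have hm : 0 < a₂.natAbs * n₀ := Nat.mul_pos (Int.natAbs_pos.2 ha₂) hn₀
  haveI : NeZero (a₂.natAbs * n₀) := ⟨hm.ne'⟩
  -- the classes `c₀ = λ₂ δ₂⁻¹`, `d₀ = λ₁ δ₁⁻¹`
  have hδ₂u : IsUnit ((δ₂ : ℕ) : ZMod (a₂.natAbs * n₀)) := (ZMod.isUnit_iff_coprime _ _).2 hδ₂m
  have hδ₁u : IsUnit ((δ₁ : ℕ) : ZMod (a₂.natAbs * n₀)) := (ZMod.isUnit_iff_coprime _ _).2 hδ₁m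
  have hl₂u : IsUnit ((l₂ : ℕ) : ZMod (a₂.natAbs * n₀)) := (ZMod.isUnit_iff_coprime _ _).2 hl₂
  have hl₁u : IsUnit ((l₁ : ℕ) : ZMod (a₂.natAbs * n₀)) := (ZMod.isUnit_iff_coprime _ _).2 hl₁
  set c₀ : ℕ := (((l₂ : ℕ) : ZMod (a₂.natAbs * n₀)) * (((δ₂ : ℕ) : ZMod (a₂.natAbs * n₀)))⁻¹).val
    with hc₀def
  set d₀ : ℕ := (((l₁ : ℕ) : ZMod (a₂.natAbs * n₀)) * (((δ₁ : ℕ) : ZMod (a₂.natAbs * n₀)))⁻¹).val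
    with hd₀def
  have hc₀ : δ₂ * c₀ ≡ l₂ [MOD a₂.natAbs * n₀] := by
    rw [← ZMod.natCast_eq_natCast_iff, Nat.cast_mul, hc₀def, ZMod.natCast_zmod_val, mul_left_comm,
      ZMod.mul_inv_of_unit _ hδ₂u, mul_one]
  have hd₀ : δ₁ * d₀ ≡ l₁ [MOD a₂.natAbs * n₀] := by
    rw [← ZMod.natCast_eq_natCast_iff, Nat.cast_mul, hd₀def, ZMod.natCast_zmod_val, mul_left_comm,
      ZMod.mul_inv_of_unit _ hδ₁u, mul_one]
  have hcop : Nat.Coprime (c₀ * d₀) (a₂.natAbs * n₀) := by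
    refine Nat.Coprime.mul_left ?_ ?_
    · rw [← ZMod.isUnit_iff_coprime, hc₀def, ZMod.natCast_zmod_val]
      exact hl₂u.mul (IsUnit.of_mul_eq_one _ (ZMod.inv_mul_of_unit _ hδ₂u))
    · rw [← ZMod.isUnit_iff_coprime, hd₀def, ZMod.natCast_zmod_val]
      exact hl₁u.mul (IsUnit.of_mul_eq_one _ (ZMod.inv_mul_of_unit _ hδ₁u))
  -- the weight
  obtain ⟨hgcd, hghc, hgsup, hgder⟩ := drWeight_cruxHyps_HL hY hYS hq₀ hδ₁ hδ₂
    (κ := (q₀ : ℝ) * ξ / M * δ₁ * δ₂) (R := (a₂.natAbs : ℝ) * δ₁ * N) (S' := (δ₂ : ℝ) * N / n₀)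
    (by positivity) hR1 hS1 k hε₀ hε₀1 hΛ hΛt
  -- ranges
  have hIn : ∀ z : ℤ, (((2 ^ k : ℕ) : ℕ) : ℤ) ≤ z → z < (((2 ^ (k + 1) : ℕ) : ℕ) : ℤ) →
      z.toNat ∈ Finset.Icc 1 ⌊((2 ^ (k + 1) : ℕ) : ℝ)⌋₊ := by
    intro z h1 h2
    rw [Nat.floor_natCast, Finset.mem_Icc]
    have hk1 : 1 ≤ 2 ^ k := Nat.one_le_two_pow
    generalize (2 ^ k : ℕ) = u at h1 hk1
    generalize (2 ^ (k + 1) : ℕ) = v at h2 ⊢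
    constructor <;> omega
  have hIr : ∀ n₂ ∈ ((((BFI.dyadic N).filter (fun n : ℕ => IsCoprime (n : ℤ) a₂)).filter (fun n : ℕ => n₀ ∣ n)).image (fun n : ℕ => n / n₀)), a₂.natAbs * n₀ * δ₁ * n₂ ∈ Finset.Icc 1 ⌊2 * ((a₂.natAbs : ℝ) * δ₁ * N)⌋₊ := by
    intro n₂ hn₂
    obtain ⟨hpos, -, hdy⟩ := mem_Bset hN.le hn₀ hn₂
    have h2 := ((BFI.mem_dyadic hN.le).1 hdy).2
    rw [Finset.mem_Icc]
    refine ⟨Nat.one_le_iff_ne_zero.2 (Nat.pos_iff_ne_zero.1 (by positivity)), Nat.le_floor ?_⟩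
    push_cast at h2 ⊢
    have h0 : (0 : ℝ) ≤ (a₂.natAbs : ℝ) * δ₁ := by positivity
    calc (a₂.natAbs : ℝ) * n₀ * δ₁ * n₂ = (a₂.natAbs : ℝ) * δ₁ * ((n₀ : ℝ) * n₂) := by ring
      _ ≤ (a₂.natAbs : ℝ) * δ₁ * (2 * N) := mul_le_mul_of_nonneg_left h2 h0
      _ = 2 * ((a₂.natAbs : ℝ) * δ₁ * N) := by ring
  have hIs : ∀ n₁ ∈ ((((BFI.dyadic N).filter (fun n : ℕ => IsCoprime (n : ℤ) a₂)).filter (fun n : ℕ => n₀ ∣ n)).image (fun n : ℕ => n / n₀)), δ₂ * n₁ ∈ Finset.Icc 1 ⌊2 * ((δ₂ : ℝ) * N / n₀)⌋₊ := by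
    intro n₁ hn₁
    obtain ⟨hpos, -, hdy⟩ := mem_Bset hN.le hn₀ hn₁
    have h2 := ((BFI.mem_dyadic hN.le).1 hdy).2
    rw [Finset.mem_Icc]
    refine ⟨Nat.one_le_iff_ne_zero.2 (Nat.pos_iff_ne_zero.1 (by positivity)), Nat.le_floor ?_⟩
    have hn₀r : (0 : ℝ) < n₀ := by exact_mod_cast hn₀
    rw [show 2 * ((δ₂ : ℝ) * N / n₀) = (δ₂ : ℝ) * (2 * N) / n₀ by ring, le_div_iff₀ hn₀r]
    push_cast at h2 ⊢
    have h0 : (0 : ℝ) ≤ (δ₂ : ℝ) := by positivity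
    calc (δ₂ : ℝ) * n₁ * n₀ = (δ₂ : ℝ) * ((n₀ : ℝ) * n₁) := by ring
      _ ≤ (δ₂ : ℝ) * (2 * N) := mul_le_mul_of_nonneg_left h2 h0
  have h1N : (1 : ℝ) ≤ ((2 ^ (k + 1) : ℕ) : ℝ) := by exact_mod_cast Nat.one_le_two_pow
  -- the identity with the left-hand side of Theorem 2.1
  rw [pieceSumBlk_eq_cruxLHS_pos hN.le ha₂ hq₀ hn₀ hq₀n₀ hq₀a₂ hl₁ hl₂ hl₁lt hl₂lt hδ₁ hδ₂ hδ₁m hδ₂m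
    hc₀ hd₀ hβ ξ H (2 ^ k) (2 ^ (k + 1)) ⌊2 * (29 / 40 * S / ((q₀ : ℝ) * δ₂))⌋₊ ⌊2 * (9 / 8 * S / ((q₀ : ℝ) * δ₁))⌋₊ hIn hIr hIs
    (G := (fun q₁ q₂ : ℕ => pieceHi S Y q₀ q₁ * pieceLo S Y q₀ q₂ *
          alphaProfile ((q₀ : ℝ) * ξ / M * q₁ * q₂)))
    (g := (drWeight (pieceLo S Y ((q₀ : ℝ) * δ₂)) (pieceHi S Y ((q₀ : ℝ) * δ₁))
          ((q₀ : ℝ) * ξ / M * δ₁ * δ₂) ((2 : ℝ) ^ k) ((a₂.natAbs : ℝ) * δ₁ * N) ((δ₂ : ℝ) * N / n₀)))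
    (fun c d n r s h => drWeight_support_HL hY hYS hN ha₂ hq₀ hn₀ hδ₁ hδ₂ k c d n r s h)
    (fun c d n₁ hn₁ n₂ hn₂ h hlo hhi => G_eq_drWeight_HL hN ha₂ hn₀ hδ₁ hδ₂ 1
      (mem_Bset hN.le hn₀ hn₁).2.2 (mem_Bset hN.le hn₀ hn₂).2.2 h hlo hhi)]
  have hbsupp : ∀ n r s : ℕ, (bCoef a₁ a₂ ((((BFI.dyadic N).filter (fun n : ℕ => IsCoprime (n : ℤ) a₂)).filter (fun n : ℕ => n₀ ∣ n)).image (fun n : ℕ => n / n₀)) q₀ n₀ l₁ l₂ β ξ H 1 (2 ^ k) (2 ^ (k + 1)) δ₁ δ₂) n r s ≠ 0 →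
      (0 < n ∧ (n : ℝ) ≤ ((2 ^ (k + 1) : ℕ) : ℝ) ∧ ((a₂.natAbs : ℝ) * δ₁ * N) < r ∧
        (r : ℝ) ≤ 2 * ((a₂.natAbs : ℝ) * δ₁ * N) ∧ ((δ₂ : ℝ) * N / n₀) < s ∧
        (s : ℝ) ≤ 2 * ((δ₂ : ℝ) * N / n₀)) := by
    intro n r s hb
    rw [bCoef_eq_bGen] at hb
    exact bGen_support hN.le ha₂ hn₀ hδ₁ hδ₂ Nat.one_le_two_pow H _ hb
  exact hcrux (29 / 40 * S / ((q₀ : ℝ) * δ₂)) (9 / 8 * S / ((q₀ : ℝ) * δ₁)) ((2 ^ (k + 1) : ℕ) : ℝ) ((a₂.natAbs : ℝ) * δ₁ * N) ((δ₂ : ℝ) * N / n₀)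
    hC1 hD1 h1N hR1 hS1 (a₂.natAbs * n₀) c₀ d₀ hm hcop
    (bCoef a₁ a₂ ((((BFI.dyadic N).filter (fun n : ℕ => IsCoprime (n : ℤ) a₂)).filter (fun n : ℕ => n₀ ∣ n)).image (fun n : ℕ => n / n₀)) q₀ n₀ l₁ l₂ β ξ H 1 (2 ^ k) (2 ^ (k + 1)) δ₁ δ₂) hbsupp
    (drWeight (pieceLo S Y ((q₀ : ℝ) * δ₂)) (pieceHi S Y ((q₀ : ℝ) * δ₁))
          ((q₀ : ℝ) * ξ / M * δ₁ * δ₂) ((2 : ℝ) ^ k) ((a₂.natAbs : ℝ) * δ₁ * N) ((δ₂ : ℝ) * N / n₀)) hgcd hghc hgsup hgder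

/-- **A blocked piece of `ℛ₁''` (pieces `HL`, negative block) is bounded by the right-hand side of
Theorem 2.1** (`𝐪 = |a₂|n₀`, `C = C_j`, `D = C_i`, `𝐍 = 2^{k+1}`, `R = |a₂|δ₁N`, `𝐒 = δ₂N/n₀`).
[cite: Drappeau2017, §5.5 p. 21, (5.24)] -/
theorem blk_le_crux_HL_neg {S Y N M ξ : ℝ} (hY : 0 < Y) (hYS : Y ≤ S / 4) (hN : 0 < N)
    (hM : 0 ≤ M) (hξ : 0 ≤ ξ) {a₁ a₂ : ℤ} (ha₂ : a₂ ≠ 0) {q₀ n₀ : ℕ} (hq₀ : 0 < q₀) (hn₀ : 0 < n₀)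
    (hq₀n₀ : Nat.Coprime q₀ n₀) (hq₀a₂ : IsCoprime (q₀ : ℤ) a₂)
    {l₁ l₂ : ℕ} (hl₁ : Nat.Coprime l₁ (a₂.natAbs * n₀)) (hl₂ : Nat.Coprime l₂ (a₂.natAbs * n₀))
    (hl₁lt : l₁ < a₂.natAbs * n₀) (hl₂lt : l₂ < a₂.natAbs * n₀)
    {δ₁ δ₂ : ℕ} (hδ₁ : 0 < δ₁) (hδ₂ : 0 < δ₂) (hδ₁m : Nat.Coprime δ₁ (a₂.natAbs * n₀))
    (hδ₂m : Nat.Coprime δ₂ (a₂.natAbs * n₀))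
    {β : ℕ → ℂ} (hβ : ∀ n, ¬Squarefree n → β n = 0) (H k : ℕ)
    (hC1 : (1 : ℝ) ≤ (29 / 40 * S / ((q₀ : ℝ) * δ₂))) (hD1 : (1 : ℝ) ≤ (9 / 8 * S / ((q₀ : ℝ) * δ₁)))
    (hR1 : (1 : ℝ) ≤ (a₂.natAbs : ℝ) * δ₁ * N) (hS1 : (1 : ℝ) ≤ (δ₂ : ℝ) * N / n₀)
    {ε₀ Λ : ℝ} (hε₀ : 0 ≤ ε₀) (hε₀1 : ε₀ ≤ 1) (hΛ : 0 ≤ Λ)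
    (hΛt : ∀ t : ℝ, (S - Y) / ((q₀ : ℝ) * ((δ₁ : ℝ) * δ₂)) ≤ t →
      (2 * S + Y) / Y + 29 + 3 ≤ Λ * t ^ ε₀)
    {A e : ℝ}
    (hcrux : (∀ C D N R S : ℝ, 1 ≤ C → 1 ≤ D → 1 ≤ N → 1 ≤ R → 1 ≤ S →
      ∀ q c₀ d₀ : ℕ, 0 < q → Nat.Coprime (c₀ * d₀) q →
      ∀ b : ℕ → ℕ → ℕ → ℂ,
        (∀ n r s : ℕ, b n r s ≠ 0 →
          (0 < n ∧ (n : ℝ) ≤ N ∧ R < r ∧ (r : ℝ) ≤ 2 * R ∧ S < s ∧ (s : ℝ) ≤ 2 * S)) →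
      ∀ g : ℝ → ℝ → ℝ → ℝ → ℝ → ℂ,
        ContDiff ℝ (⊤ : ℕ∞) (fun p : Fin 5 → ℝ => g (p 0) (p 1) (p 2) (p 3) (p 4)) →
        HasCompactSupport (fun p : Fin 5 → ℝ => g (p 0) (p 1) (p 2) (p 3) (p 4)) →
        (∀ c d n r s : ℝ, g c d n r s ≠ 0 →
          (C < c ∧ c ≤ 2 * C ∧ D < d ∧ d ≤ 2 * D ∧ 0 < n ∧ 0 < r ∧ 0 < s)) →
        (∀ ν : Fin 5 → ℕ, ∀ c d n r s : ℝ, 0 < c → 0 < d → 0 < n → 0 < r → 0 < s →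
          ‖mixedDeriv ν g c d n r s‖ ≤ KnuFamily Λ ν *
            (c ^ (-(ν 0 : ℝ)) * d ^ (-(ν 1 : ℝ)) * n ^ (-(ν 2 : ℝ)) * r ^ (-(ν 3 : ℝ)) *
              s ^ (-(ν 4 : ℝ))) ^ (1 - ε₀)) →
        ‖∑ c ∈ Finset.Icc 1 ⌊2 * C⌋₊, ∑ d ∈ Finset.Icc 1 ⌊2 * D⌋₊, ∑ n ∈ Finset.Icc 1 ⌊N⌋₊, ∑ r ∈ Finset.Icc 1 ⌊2 * R⌋₊,
            ∑ s ∈ Finset.Icc 1 ⌊2 * S⌋₊,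
            (if (c ≡ c₀ [MOD q] ∧ d ≡ d₀ [MOD q] ∧ Nat.Coprime (q * r * d) (s * c)) then
              b n r s * g c d n r s *
                (𝐞 ((n : ℝ) * ((((r * d : ℕ) : ZMod (s * c))⁻¹).val : ℝ) / ((s : ℝ) * c)) : ℂ)
            else 0)‖ ≤
          A * ((q : ℝ) * C * D * N * R * S) ^ e * (q : ℝ) ^ (3 / 2 : ℝ) *
            Real.sqrt
              ((q : ℝ) ^ 2 * (C * S * (R * S + N) * (C + R * D) + S * N * R) *
                  (∑ n ∈ Finset.Icc 1 ⌊N⌋₊, ∑ r ∈ Finset.Icc 1 ⌊2 * R⌋₊, ∑ s ∈ Finset.Icc 1 ⌊2 * S⌋₊, ‖b n r s‖ ^ 2) +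
                (q : ℝ) * (C ^ 2 * D * S * Real.sqrt (R * (R * S + N)) + D ^ 2 * N * R) *
                  (∑ n ∈ Finset.Icc 1 ⌊N⌋₊, ∑ r ∈ Finset.Icc 1 ⌊2 * R⌋₊, ∑ s ∈ Finset.Icc 1 ⌊2 * S⌋₊, ‖b n r s‖ ^ 2)))) :
    ‖pieceSumBlk a₁ a₂ (((((((BFI.mRange S Y).filter (fun q : ℕ => 0 < q)).filter (fun q : ℕ => IsCoprime (q : ℤ) a₂)).filter (fun q : ℕ => q₀ ∣ q)).image (fun q : ℕ => q / q₀)).filter (fun q : ℕ => q % (a₂.natAbs * n₀) = l₁)).filter (fun q : ℕ => δ₁ ∣ q))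
        (((((((BFI.mRange S Y).filter (fun q : ℕ => 0 < q)).filter (fun q : ℕ => IsCoprime (q : ℤ) a₂)).filter (fun q : ℕ => q₀ ∣ q)).image (fun q : ℕ => q / q₀)).filter (fun q : ℕ => q % (a₂.natAbs * n₀) = l₂)).filter (fun q : ℕ => δ₂ ∣ q)) ((((BFI.dyadic N).filter (fun n : ℕ => IsCoprime (n : ℤ) a₂)).filter (fun n : ℕ => n₀ ∣ n)).image (fun n : ℕ => n / n₀))
        q₀ n₀ l₁ l₂ β ξ (fun q₁ q₂ : ℕ => pieceHi S Y q₀ q₁ * pieceLo S Y q₀ q₂ *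
          alphaProfile ((q₀ : ℝ) * ξ / M * q₁ * q₂)) H (-1) (2 ^ k) (2 ^ (k + 1))‖ ≤
      A * (((a₂.natAbs * n₀ : ℕ) : ℝ) * (29 / 40 * S / ((q₀ : ℝ) * δ₂)) * (9 / 8 * S / ((q₀ : ℝ) * δ₁)) * ((2 ^ (k + 1) : ℕ) : ℝ) * ((a₂.natAbs : ℝ) * δ₁ * N) * ((δ₂ : ℝ) * N / n₀)) ^ e * ((a₂.natAbs * n₀ : ℕ) : ℝ) ^ (3 / 2 : ℝ) *
        Real.sqrt (((a₂.natAbs * n₀ : ℕ) : ℝ) ^ 2 * ((29 / 40 * S / ((q₀ : ℝ) * δ₂)) * ((δ₂ : ℝ) * N / n₀) * (((a₂.natAbs : ℝ) * δ₁ * N) * ((δ₂ : ℝ) * N / n₀) + ((2 ^ (k + 1) : ℕ) : ℝ)) * ((29 / 40 * S / ((q₀ : ℝ) * δ₂)) + ((a₂.natAbs : ℝ) * δ₁ * N) * (9 / 8 * S / ((q₀ : ℝ) * δ₁))) + ((δ₂ : ℝ) * N / n₀) * ((2 ^ (k + 1) : ℕ) : ℝ) * ((a₂.natAbs : ℝ)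 * δ₁ * N)) *
              (∑ n ∈ Finset.Icc 1 ⌊((2 ^ (k + 1) : ℕ) : ℝ)⌋₊, ∑ r ∈ Finset.Icc 1 ⌊2 * ((a₂.natAbs : ℝ) * δ₁ * N)⌋₊, ∑ s ∈ Finset.Icc 1 ⌊2 * ((δ₂ : ℝ) * N / n₀)⌋₊, ‖(bGen a₁ a₂ ((((BFI.dyadic N).filter (fun n : ℕ => IsCoprime (n : ℤ) a₂)).filter (fun n : ℕ => n₀ ∣ n)).image (fun n : ℕ => n / n₀)) q₀ n₀ H (-1) (2 ^ k) (2 ^ (k + 1)) δ₁ δ₂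
            (fun h n₁ n₂ => starRingEnd ℂ (β (n₀ * n₁) * starRingEnd ℂ (β (n₀ * n₂)) *
              ((𝐞 (-(ξ * h)) : ℂ) *
                (𝐞 (-((h : ℝ) * a₁ *
                    ((((((q₀ : ℤ) * l₁ * l₂ * n₁ : ℤ) : ZMod (a₂.natAbs * n₀))⁻¹).val : ℕ) : ℝ) /
                      ((a₂ : ℝ) * n₀))) : ℂ))))) n r s‖ ^ 2) +
            ((a₂.natAbs * n₀ : ℕ) : ℝ) * ((29 / 40 * S / ((q₀ : ℝ) * δ₂)) ^ 2 * (9 / 8 * S / ((q₀ : ℝ) * δ₁)) * ((δ₂ : ℝ) * N / n₀) * Real.sqrt (((a₂.natAbs : ℝ) * δ₁ * N) * (((a₂.natAbs : ℝ) * δ₁ * N) * ((δ₂ : ℝ) * N / n₀) + ((2 ^ (k + 1) : ℕ) : ℝ))) + (9 / 8 * S / ((q₀ : ℝ) * δ₁)) ^ 2 * ((2 ^ (k + 1) : ℕ) : ℝ) * ((a₂.natAbs : ℝ) * δ₁ * N)) *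
              (∑ n ∈ Finset.Icc 1 ⌊((2 ^ (k + 1) : ℕ) : ℝ)⌋₊, ∑ r ∈ Finset.Icc 1 ⌊2 * ((a₂.natAbs : ℝ) * δ₁ * N)⌋₊, ∑ s ∈ Finset.Icc 1 ⌊2 * ((δ₂ : ℝ) * N / n₀)⌋₊, ‖(bGen a₁ a₂ ((((BFI.dyadic N).filter (fun n : ℕ => IsCoprime (n : ℤ) a₂)).filter (fun n : ℕ => n₀ ∣ n)).image (fun n : ℕ => n / n₀)) q₀ n₀ H (-1) (2 ^ k) (2 ^ (k + 1)) δ₁ δ₂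
            (fun h n₁ n₂ => starRingEnd ℂ (β (n₀ * n₁) * starRingEnd ℂ (β (n₀ * n₂)) *
              ((𝐞 (-(ξ * h)) : ℂ) *
                (𝐞 (-((h : ℝ) * a₁ *
                    ((((((q₀ : ℤ) * l₁ * l₂ * n₁ : ℤ) : ZMod (a₂.natAbs * n₀))⁻¹).val : ℕ) : ℝ) /
                      ((a₂ : ℝ) * n₀))) : ℂ))))) n r s‖ ^ 2)) := by
  have hm : 0 < a₂.natAbs * n₀ := Nat.mul_pos (Int.natAbs_pos.2 ha₂) hn₀
  haveI : NeZero (a₂.natAbs * n₀) := ⟨hm.ne'⟩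
  -- the classes `c₀ = λ₂ δ₂⁻¹`, `d₀ = λ₁ δ₁⁻¹`
  have hδ₂u : IsUnit ((δ₂ : ℕ) : ZMod (a₂.natAbs * n₀)) := (ZMod.isUnit_iff_coprime _ _).2 hδ₂m
  have hδ₁u : IsUnit ((δ₁ : ℕ) : ZMod (a₂.natAbs * n₀)) := (ZMod.isUnit_iff_coprime _ _).2 hδ₁m
  have hl₂u : IsUnit ((l₂ : ℕ) : ZMod (a₂.natAbs * n₀)) := (ZMod.isUnit_iff_coprime _ _).2 hl₂
  have hl₁u : IsUnit ((l₁ : ℕ) : ZMod (a₂.natAbs * n₀)) := (ZMod.isUnit_iff_coprime _ _).2 hl₁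
  set c₀ : ℕ := (((l₂ : ℕ) : ZMod (a₂.natAbs * n₀)) * (((δ₂ : ℕ) : ZMod (a₂.natAbs * n₀)))⁻¹).val
    with hc₀def
  set d₀ : ℕ := (((l₁ : ℕ) : ZMod (a₂.natAbs * n₀)) * (((δ₁ : ℕ) : ZMod (a₂.natAbs * n₀)))⁻¹).val
    with hd₀def
  have hc₀ : δ₂ * c₀ ≡ l₂ [MOD a₂.natAbs * n₀] := by
    rw [← ZMod.natCast_eq_natCast_iff, Nat.cast_mul, hc₀def, ZMod.natCast_zmod_val, mul_left_comm,
      ZMod.mul_inv_of_unit _ hδ₂u, mul_one]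
  have hd₀ : δ₁ * d₀ ≡ l₁ [MOD a₂.natAbs * n₀] := by
    rw [← ZMod.natCast_eq_natCast_iff, Nat.cast_mul, hd₀def, ZMod.natCast_zmod_val, mul_left_comm,
      ZMod.mul_inv_of_unit _ hδ₁u, mul_one]
  have hcop : Nat.Coprime (c₀ * d₀) (a₂.natAbs * n₀) := by
    refine Nat.Coprime.mul_left ?_ ?_
    · rw [← ZMod.isUnit_iff_coprime, hc₀def, ZMod.natCast_zmod_val]
      exact hl₂u.mul (IsUnit.of_mul_eq_one _ (ZMod.inv_mul_of_unit _ hδ₂u))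
    · rw [← ZMod.isUnit_iff_coprime, hd₀def, ZMod.natCast_zmod_val]
      exact hl₁u.mul (IsUnit.of_mul_eq_one _ (ZMod.inv_mul_of_unit _ hδ₁u))
  -- the weight
  obtain ⟨hgcd, hghc, hgsup, hgder⟩ := drWeight_cruxHyps_HL hY hYS hq₀ hδ₁ hδ₂
    (κ := (q₀ : ℝ) * ξ / M * δ₁ * δ₂) (R := (a₂.natAbs : ℝ) * δ₁ * N) (S' := (δ₂ : ℝ) * N / n₀)
    (by positivity) hR1 hS1 k hε₀ hε₀1 hΛ hΛt
  -- ranges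
  have hIn : ∀ z : ℤ, (((2 ^ k : ℕ) : ℕ) : ℤ) ≤ z → z < (((2 ^ (k + 1) : ℕ) : ℕ) : ℤ) →
      z.toNat ∈ Finset.Icc 1 ⌊((2 ^ (k + 1) : ℕ) : ℝ)⌋₊ := by
    intro z h1 h2
    rw [Nat.floor_natCast, Finset.mem_Icc]
    have hk1 : 1 ≤ 2 ^ k := Nat.one_le_two_pow
    generalize (2 ^ k : ℕ) = u at h1 hk1
    generalize (2 ^ (k + 1) : ℕ) = v at h2 ⊢
    constructor <;> omega
  have hIr : ∀ n₂ ∈ ((((BFI.dyadic N).filter (fun n : ℕ => IsCoprime (n : ℤ) a₂)).filter (fun n : ℕ => n₀ ∣ n)).image (fun n : ℕ => n / n₀)), a₂.natAbs * n₀ * δ₁ * n₂ ∈ Finset.Icc 1 ⌊2 * ((a₂.natAbs : ℝ) * δ₁ * N)⌋₊ := by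
    intro n₂ hn₂
    obtain ⟨hpos, -, hdy⟩ := mem_Bset hN.le hn₀ hn₂
    have h2 := ((BFI.mem_dyadic hN.le).1 hdy).2
    rw [Finset.mem_Icc]
    refine ⟨Nat.one_le_iff_ne_zero.2 (Nat.pos_iff_ne_zero.1 (by positivity)), Nat.le_floor ?_⟩
    push_cast at h2 ⊢
    have h0 : (0 : ℝ) ≤ (a₂.natAbs : ℝ) * δ₁ := by positivity
    calc (a₂.natAbs : ℝ) * n₀ * δ₁ * n₂ = (a₂.natAbs : ℝ) * δ₁ * ((n₀ : ℝ) * n₂) := by ring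
      _ ≤ (a₂.natAbs : ℝ) * δ₁ * (2 * N) := mul_le_mul_of_nonneg_left h2 h0
      _ = 2 * ((a₂.natAbs : ℝ) * δ₁ * N) := by ring
  have hIs : ∀ n₁ ∈ ((((BFI.dyadic N).filter (fun n : ℕ => IsCoprime (n : ℤ) a₂)).filter (fun n : ℕ => n₀ ∣ n)).image (fun n : ℕ => n / n₀)), δ₂ * n₁ ∈ Finset.Icc 1 ⌊2 * ((δ₂ : ℝ) * N / n₀)⌋₊ := by
    intro n₁ hn₁
    obtain ⟨hpos, -, hdy⟩ := mem_Bset hN.le hn₀ hn₁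
    have h2 := ((BFI.mem_dyadic hN.le).1 hdy).2
    rw [Finset.mem_Icc]
    refine ⟨Nat.one_le_iff_ne_zero.2 (Nat.pos_iff_ne_zero.1 (by positivity)), Nat.le_floor ?_⟩
    have hn₀r : (0 : ℝ) < n₀ := by exact_mod_cast hn₀
    rw [show 2 * ((δ₂ : ℝ) * N / n₀) = (δ₂ : ℝ) * (2 * N) / n₀ by ring, le_div_iff₀ hn₀r]
    push_cast at h2 ⊢
    have h0 : (0 : ℝ) ≤ (δ₂ : ℝ) := by positivity
    calc (δ₂ : ℝ) * n₁ * n₀ = (δ₂ : ℝ) * ((n₀ : ℝ) * n₁) := by ring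
      _ ≤ (δ₂ : ℝ) * (2 * N) := mul_le_mul_of_nonneg_left h2 h0
  have h1N : (1 : ℝ) ≤ ((2 ^ (k + 1) : ℕ) : ℝ) := by exact_mod_cast Nat.one_le_two_pow
  -- conjugate, then the identity with the left-hand side of Theorem 2.1
  rw [← Complex.norm_conj (pieceSumBlk a₁ a₂ (((((((BFI.mRange S Y).filter (fun q : ℕ => 0 < q)).filter (fun q : ℕ => IsCoprime (q : ℤ) a₂)).filter (fun q : ℕ => q₀ ∣ q)).image (fun q : ℕ => q / q₀)).filter (fun q : ℕ => q % (a₂.natAbs * n₀) = l₁)).filter (fun q : ℕ => δ₁ ∣ q))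
        (((((((BFI.mRange S Y).filter (fun q : ℕ => 0 < q)).filter (fun q : ℕ => IsCoprime (q : ℤ) a₂)).filter (fun q : ℕ => q₀ ∣ q)).image (fun q : ℕ => q / q₀)).filter (fun q : ℕ => q % (a₂.natAbs * n₀) = l₂)).filter (fun q : ℕ => δ₂ ∣ q)) ((((BFI.dyadic N).filter (fun n : ℕ => IsCoprime (n : ℤ) a₂)).filter (fun n : ℕ => n₀ ∣ n)).image (fun n : ℕ => n / n₀))
        q₀ n₀ l₁ l₂ β ξ (fun q₁ q₂ : ℕ => pieceHi S Y q₀ q₁ * pieceLo S Y q₀ q₂ *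
          alphaProfile ((q₀ : ℝ) * ξ / M * q₁ * q₂)) H (-1) (2 ^ k) (2 ^ (k + 1)))]
  rw [conj_pieceSumBlk_eq_cruxLHS_neg hN.le ha₂ hq₀ hn₀ hq₀n₀ hq₀a₂ hl₁ hl₂ hl₁lt hl₂lt hδ₁ hδ₂ hδ₁m hδ₂m
    hc₀ hd₀ hβ ξ H (2 ^ k) (2 ^ (k + 1)) ⌊2 * (29 / 40 * S / ((q₀ : ℝ) * δ₂))⌋₊ ⌊2 * (9 / 8 * S / ((q₀ : ℝ) * δ₁))⌋₊ hIn hIr hIs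
    (G := (fun q₁ q₂ : ℕ => pieceHi S Y q₀ q₁ * pieceLo S Y q₀ q₂ *
          alphaProfile ((q₀ : ℝ) * ξ / M * q₁ * q₂)))
    (g := (drWeight (pieceLo S Y ((q₀ : ℝ) * δ₂)) (pieceHi S Y ((q₀ : ℝ) * δ₁))
          ((q₀ : ℝ) * ξ / M * δ₁ * δ₂) ((2 : ℝ) ^ k) ((a₂.natAbs : ℝ) * δ₁ * N) ((δ₂ : ℝ) * N / n₀)))
    (fun c d n r s h => drWeight_support_HL hY hYS hN ha₂ hq₀ hn₀ hδ₁ hδ₂ k c d n r s h)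
    (conj_G_HL S Y ξ M q₀)
    (fun c d n₁ hn₁ n₂ hn₂ h hlo hhi => G_eq_drWeight_HL hN ha₂ hn₀ hδ₁ hδ₂ (-1)
      (mem_Bset hN.le hn₀ hn₁).2.2 (mem_Bset hN.le hn₀ hn₂).2.2 h hlo hhi)]
  have hbsupp : ∀ n r s : ℕ, (bGen a₁ a₂ ((((BFI.dyadic N).filter (fun n : ℕ => IsCoprime (n : ℤ) a₂)).filter (fun n : ℕ => n₀ ∣ n)).image (fun n : ℕ => n / n₀)) q₀ n₀ H (-1) (2 ^ k) (2 ^ (k + 1)) δ₁ δ₂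
            (fun h n₁ n₂ => starRingEnd ℂ (β (n₀ * n₁) * starRingEnd ℂ (β (n₀ * n₂)) *
              ((𝐞 (-(ξ * h)) : ℂ) *
                (𝐞 (-((h : ℝ) * a₁ *
                    ((((((q₀ : ℤ) * l₁ * l₂ * n₁ : ℤ) : ZMod (a₂.natAbs * n₀))⁻¹).val : ℕ) : ℝ) /
                      ((a₂ : ℝ) * n₀))) : ℂ))))) n r s ≠ 0 →
      (0 < n ∧ (n : ℝ) ≤ ((2 ^ (k + 1) : ℕ) : ℝ) ∧ ((a₂.natAbs : ℝ) * δ₁ * N) < r ∧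
        (r : ℝ) ≤ 2 * ((a₂.natAbs : ℝ) * δ₁ * N) ∧ ((δ₂ : ℝ) * N / n₀) < s ∧
        (s : ℝ) ≤ 2 * ((δ₂ : ℝ) * N / n₀)) :=
    fun n r s hb => bGen_support hN.le ha₂ hn₀ hδ₁ hδ₂ Nat.one_le_two_pow H _ hb
  exact hcrux (29 / 40 * S / ((q₀ : ℝ) * δ₂)) (9 / 8 * S / ((q₀ : ℝ) * δ₁)) ((2 ^ (k + 1) : ℕ) : ℝ) ((a₂.natAbs : ℝ) * δ₁ * N) ((δ₂ : ℝ) * N / n₀)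
    hC1 hD1 h1N hR1 hS1 (a₂.natAbs * n₀) c₀ d₀ hm hcop
    (bGen a₁ a₂ ((((BFI.dyadic N).filter (fun n : ℕ => IsCoprime (n : ℤ) a₂)).filter (fun n : ℕ => n₀ ∣ n)).image (fun n : ℕ => n / n₀)) q₀ n₀ H (-1) (2 ^ k) (2 ^ (k + 1)) δ₁ δ₂
            (fun h n₁ n₂ => starRingEnd ℂ (β (n₀ * n₁) * starRingEnd ℂ (β (n₀ * n₂)) *
              ((𝐞 (-(ξ * h)) : ℂ) *
                (𝐞 (-((h : ℝ) * a₁ *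
                    ((((((q₀ : ℤ) * l₁ * l₂ * n₁ : ℤ) : ZMod (a₂.natAbs * n₀))⁻¹).val : ℕ) : ℝ) /
                      ((a₂ : ℝ) * n₀))) : ℂ))))) hbsupp
    (drWeight (pieceLo S Y ((q₀ : ℝ) * δ₂)) (pieceHi S Y ((q₀ : ℝ) * δ₁))
          ((q₀ : ℝ) * ξ / M * δ₁ * δ₂) ((2 : ℝ) ^ k) ((a₂.natAbs : ℝ) * δ₁ * N) ((δ₂ : ℝ) * N / n₀)) hgcd hghc hgsup hgder

/-- **A blocked piece of `ℛ₁''` (pieces `HH`, positive block) is bounded by the right-hand side of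
Theorem 2.1** (`𝐪 = |a₂|n₀`, `C = C_j`, `D = C_i`, `𝐍 = 2^{k+1}`, `R = |a₂|δ₁N`, `𝐒 = δ₂N/n₀`).
[cite: Drappeau2017, §5.5 p. 21, (5.24)] -/
theorem blk_le_crux_HH_pos {S Y N M ξ : ℝ} (hY : 0 < Y) (hYS : Y ≤ S / 4) (hN : 0 < N)
    (hM : 0 ≤ M) (hξ : 0 ≤ ξ) {a₁ a₂ : ℤ} (ha₂ : a₂ ≠ 0) {q₀ n₀ : ℕ} (hq₀ : 0 < q₀) (hn₀ : 0 < n₀)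
    (hq₀n₀ : Nat.Coprime q₀ n₀) (hq₀a₂ : IsCoprime (q₀ : ℤ) a₂)
    {l₁ l₂ : ℕ} (hl₁ : Nat.Coprime l₁ (a₂.natAbs * n₀)) (hl₂ : Nat.Coprime l₂ (a₂.natAbs * n₀))
    (hl₁lt : l₁ < a₂.natAbs * n₀) (hl₂lt : l₂ < a₂.natAbs * n₀)
    {δ₁ δ₂ : ℕ} (hδ₁ : 0 < δ₁) (hδ₂ : 0 < δ₂) (hδ₁m : Nat.Coprime δ₁ (a₂.natAbs * n₀))
    (hδ₂m : Nat.Coprime δ₂ (a₂.natAbs * n₀))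
    {β : ℕ → ℂ} (hβ : ∀ n, ¬Squarefree n → β n = 0) (H k : ℕ)
    (hC1 : (1 : ℝ) ≤ (9 / 8 * S / ((q₀ : ℝ) * δ₂))) (hD1 : (1 : ℝ) ≤ (9 / 8 * S / ((q₀ : ℝ) * δ₁)))
    (hR1 : (1 : ℝ) ≤ (a₂.natAbs : ℝ) * δ₁ * N) (hS1 : (1 : ℝ) ≤ (δ₂ : ℝ) * N / n₀)
    {ε₀ Λ : ℝ} (hε₀ : 0 ≤ ε₀) (hε₀1 : ε₀ ≤ 1) (hΛ : 0 ≤ Λ)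
    (hΛt : ∀ t : ℝ, (S - Y) / ((q₀ : ℝ) * ((δ₁ : ℝ) * δ₂)) ≤ t →
      (2 * S + Y) / Y + 29 + 3 ≤ Λ * t ^ ε₀)
    {A e : ℝ}
    (hcrux : (∀ C D N R S : ℝ, 1 ≤ C → 1 ≤ D → 1 ≤ N → 1 ≤ R → 1 ≤ S →
      ∀ q c₀ d₀ : ℕ, 0 < q → Nat.Coprime (c₀ * d₀) q →
      ∀ b : ℕ → ℕ → ℕ → ℂ,
        (∀ n r s : ℕ, b n r s ≠ 0 →
          (0 < n ∧ (n : ℝ) ≤ N ∧ R < r ∧ (r : ℝ) ≤ 2 * R ∧ S < s ∧ (s : ℝ) ≤ 2 * S)) →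
      ∀ g : ℝ → ℝ → ℝ → ℝ → ℝ → ℂ,
        ContDiff ℝ (⊤ : ℕ∞) (fun p : Fin 5 → ℝ => g (p 0) (p 1) (p 2) (p 3) (p 4)) →
        HasCompactSupport (fun p : Fin 5 → ℝ => g (p 0) (p 1) (p 2) (p 3) (p 4)) →
        (∀ c d n r s : ℝ, g c d n r s ≠ 0 →
          (C < c ∧ c ≤ 2 * C ∧ D < d ∧ d ≤ 2 * D ∧ 0 < n ∧ 0 < r ∧ 0 < s)) →
        (∀ ν : Fin 5 → ℕ, ∀ c d n r s : ℝ, 0 < c → 0 < d → 0 < n → 0 < r → 0 < s →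
          ‖mixedDeriv ν g c d n r s‖ ≤ KnuFamily Λ ν *
            (c ^ (-(ν 0 : ℝ)) * d ^ (-(ν 1 : ℝ)) * n ^ (-(ν 2 : ℝ)) * r ^ (-(ν 3 : ℝ)) *
              s ^ (-(ν 4 : ℝ))) ^ (1 - ε₀)) →
        ‖∑ c ∈ Finset.Icc 1 ⌊2 * C⌋₊, ∑ d ∈ Finset.Icc 1 ⌊2 * D⌋₊, ∑ n ∈ Finset.Icc 1 ⌊N⌋₊, ∑ r ∈ Finset.Icc 1 ⌊2 * R⌋₊,
            ∑ s ∈ Finset.Icc 1 ⌊2 * S⌋₊,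
            (if (c ≡ c₀ [MOD q] ∧ d ≡ d₀ [MOD q] ∧ Nat.Coprime (q * r * d) (s * c)) then
              b n r s * g c d n r s *
                (𝐞 ((n : ℝ) * ((((r * d : ℕ) : ZMod (s * c))⁻¹).val : ℝ) / ((s : ℝ) * c)) : ℂ)
            else 0)‖ ≤
          A * ((q : ℝ) * C * D * N * R * S) ^ e * (q : ℝ) ^ (3 / 2 : ℝ) *
            Real.sqrt
              ((q : ℝ) ^ 2 * (C * S * (R * S + N) * (C + R * D) + S * N * R) *
                  (∑ n ∈ Finset.Icc 1 ⌊N⌋₊, ∑ r ∈ Finset.Icc 1 ⌊2 * R⌋₊, ∑ s ∈ Finset.Icc 1 ⌊2 * S⌋₊, ‖b n r s‖ ^ 2) +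
                (q : ℝ) * (C ^ 2 * D * S * Real.sqrt (R * (R * S + N)) + D ^ 2 * N * R) *
                  (∑ n ∈ Finset.Icc 1 ⌊N⌋₊, ∑ r ∈ Finset.Icc 1 ⌊2 * R⌋₊, ∑ s ∈ Finset.Icc 1 ⌊2 * S⌋₊, ‖b n r s‖ ^ 2)))) :
    ‖pieceSumBlk a₁ a₂ (((((((BFI.mRange S Y).filter (fun q : ℕ => 0 < q)).filter (fun q : ℕ => IsCoprime (q : ℤ) a₂)).filter (fun q : ℕ => q₀ ∣ q)).image (fun q : ℕ => q / q₀)).filter (fun q : ℕ => q % (a₂.natAbs * n₀) = l₁)).filter (fun q : ℕ => δ₁ ∣ q))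
        (((((((BFI.mRange S Y).filter (fun q : ℕ => 0 < q)).filter (fun q : ℕ => IsCoprime (q : ℤ) a₂)).filter (fun q : ℕ => q₀ ∣ q)).image (fun q : ℕ => q / q₀)).filter (fun q : ℕ => q % (a₂.natAbs * n₀) = l₂)).filter (fun q : ℕ => δ₂ ∣ q)) ((((BFI.dyadic N).filter (fun n : ℕ => IsCoprime (n : ℤ) a₂)).filter (fun n : ℕ => n₀ ∣ n)).image (fun n : ℕ => n / n₀))
        q₀ n₀ l₁ l₂ β ξ (fun q₁ q₂ : ℕ => pieceHi S Y q₀ q₁ * pieceHi S Y q₀ q₂ *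
          alphaProfile ((q₀ : ℝ) * ξ / M * q₁ * q₂)) H 1 (2 ^ k) (2 ^ (k + 1))‖ ≤
      A * (((a₂.natAbs * n₀ : ℕ) : ℝ) * (9 / 8 * S / ((q₀ : ℝ) * δ₂)) * (9 / 8 * S / ((q₀ : ℝ) * δ₁)) * ((2 ^ (k + 1) : ℕ) : ℝ) * ((a₂.natAbs : ℝ) * δ₁ * N) * ((δ₂ : ℝ) * N / n₀)) ^ e * ((a₂.natAbs * n₀ : ℕ) : ℝ) ^ (3 / 2 : ℝ) *
        Real.sqrt (((a₂.natAbs * n₀ : ℕ) : ℝ) ^ 2 * ((9 / 8 * S / ((q₀ : ℝ) * δ₂)) * ((δ₂ : ℝ) * N / n₀) * (((a₂.natAbs : ℝ) * δ₁ * N) * ((δ₂ : ℝ) * N / n₀) + ((2 ^ (k + 1) : ℕ) : ℝ)) * ((9 / 8 * S / ((q₀ : ℝ) * δ₂)) + ((a₂.natAbs : ℝ) * δ₁ * N) * (9 / 8 * S / ((q₀ : ℝ) * δ₁))) + ((δ₂ : ℝ) * N / n₀) * ((2 ^ (k + 1) : ℕ) : ℝ) * ((a₂.natAbs : ℝ)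 * δ₁ * N)) *
              (∑ n ∈ Finset.Icc 1 ⌊((2 ^ (k + 1) : ℕ) : ℝ)⌋₊, ∑ r ∈ Finset.Icc 1 ⌊2 * ((a₂.natAbs : ℝ) * δ₁ * N)⌋₊, ∑ s ∈ Finset.Icc 1 ⌊2 * ((δ₂ : ℝ) * N / n₀)⌋₊, ‖(bCoef a₁ a₂ ((((BFI.dyadic N).filter (fun n : ℕ => IsCoprime (n : ℤ) a₂)).filter (fun n : ℕ => n₀ ∣ n)).image (fun n : ℕ => n / n₀)) q₀ n₀ l₁ l₂ β ξ H 1 (2 ^ k) (2 ^ (k + 1)) δ₁ δ₂) n r s‖ ^ 2) +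
            ((a₂.natAbs * n₀ : ℕ) : ℝ) * ((9 / 8 * S / ((q₀ : ℝ) * δ₂)) ^ 2 * (9 / 8 * S / ((q₀ : ℝ) * δ₁)) * ((δ₂ : ℝ) * N / n₀) * Real.sqrt (((a₂.natAbs : ℝ) * δ₁ * N) * (((a₂.natAbs : ℝ) * δ₁ * N) * ((δ₂ : ℝ) * N / n₀) + ((2 ^ (k + 1) : ℕ) : ℝ))) + (9 / 8 * S / ((q₀ : ℝ) * δ₁)) ^ 2 * ((2 ^ (k + 1) : ℕ) : ℝ) * ((a₂.natAbs : ℝ) * δ₁ * N)) *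
              (∑ n ∈ Finset.Icc 1 ⌊((2 ^ (k + 1) : ℕ) : ℝ)⌋₊, ∑ r ∈ Finset.Icc 1 ⌊2 * ((a₂.natAbs : ℝ) * δ₁ * N)⌋₊, ∑ s ∈ Finset.Icc 1 ⌊2 * ((δ₂ : ℝ) * N / n₀)⌋₊, ‖(bCoef a₁ a₂ ((((BFI.dyadic N).filter (fun n : ℕ => IsCoprime (n : ℤ) a₂)).filter (fun n : ℕ => n₀ ∣ n)).image (fun n : ℕ => n / n₀)) q₀ n₀ l₁ l₂ β ξ H 1 (2 ^ k) (2 ^ (k + 1)) δ₁ δ₂) n r s‖ ^ 2)) := by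
  have hm : 0 < a₂.natAbs * n₀ := Nat.mul_pos (Int.natAbs_pos.2 ha₂) hn₀
  haveI : NeZero (a₂.natAbs * n₀) := ⟨hm.ne'⟩
  -- the classes `c₀ = λ₂ δ₂⁻¹`, `d₀ = λ₁ δ₁⁻¹`
  have hδ₂u : IsUnit ((δ₂ : ℕ) : ZMod (a₂.natAbs * n₀)) := (ZMod.isUnit_iff_coprime _ _).2 hδ₂m
  have hδ₁u : IsUnit ((δ₁ : ℕ) : ZMod (a₂.natAbs * n₀)) := (ZMod.isUnit_iff_coprime _ _).2 hδ₁m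
  have hl₂u : IsUnit ((l₂ : ℕ) : ZMod (a₂.natAbs * n₀)) := (ZMod.isUnit_iff_coprime _ _).2 hl₂
  have hl₁u : IsUnit ((l₁ : ℕ) : ZMod (a₂.natAbs * n₀)) := (ZMod.isUnit_iff_coprime _ _).2 hl₁
  set c₀ : ℕ := (((l₂ : ℕ) : ZMod (a₂.natAbs * n₀)) * (((δ₂ : ℕ) : ZMod (a₂.natAbs * n₀)))⁻¹).val
    with hc₀def
  set d₀ : ℕ := (((l₁ : ℕ) : ZMod (a₂.natAbs * n₀)) * (((δ₁ : ℕ) : ZMod (a₂.natAbs * n₀)))⁻¹).val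
    with hd₀def
  have hc₀ : δ₂ * c₀ ≡ l₂ [MOD a₂.natAbs * n₀] := by
    rw [← ZMod.natCast_eq_natCast_iff, Nat.cast_mul, hc₀def, ZMod.natCast_zmod_val, mul_left_comm,
      ZMod.mul_inv_of_unit _ hδ₂u, mul_one]
  have hd₀ : δ₁ * d₀ ≡ l₁ [MOD a₂.natAbs * n₀] := by
    rw [← ZMod.natCast_eq_natCast_iff, Nat.cast_mul, hd₀def, ZMod.natCast_zmod_val, mul_left_comm,
      ZMod.mul_inv_of_unit _ hδ₁u, mul_one]
  have hcop : Nat.Coprime (c₀ * d₀) (a₂.natAbs * n₀) := by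
    refine Nat.Coprime.mul_left ?_ ?_
    · rw [← ZMod.isUnit_iff_coprime, hc₀def, ZMod.natCast_zmod_val]
      exact hl₂u.mul (IsUnit.of_mul_eq_one _ (ZMod.inv_mul_of_unit _ hδ₂u))
    · rw [← ZMod.isUnit_iff_coprime, hd₀def, ZMod.natCast_zmod_val]
      exact hl₁u.mul (IsUnit.of_mul_eq_one _ (ZMod.inv_mul_of_unit _ hδ₁u))
  -- the weight
  obtain ⟨hgcd, hghc, hgsup, hgder⟩ := drWeight_cruxHyps_HH hY hYS hq₀ hδ₁ hδ₂
    (κ := (q₀ : ℝ) * ξ / M * δ₁ * δ₂) (R := (a₂.natAbs : ℝ) * δ₁ * N) (S' := (δ₂ : ℝ) * N / n₀)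
    (by positivity) hR1 hS1 k hε₀ hε₀1 hΛ hΛt
  -- ranges
  have hIn : ∀ z : ℤ, (((2 ^ k : ℕ) : ℕ) : ℤ) ≤ z → z < (((2 ^ (k + 1) : ℕ) : ℕ) : ℤ) →
      z.toNat ∈ Finset.Icc 1 ⌊((2 ^ (k + 1) : ℕ) : ℝ)⌋₊ := by
    intro z h1 h2
    rw [Nat.floor_natCast, Finset.mem_Icc]
    have hk1 : 1 ≤ 2 ^ k := Nat.one_le_two_pow
    generalize (2 ^ k : ℕ) = u at h1 hk1
    generalize (2 ^ (k + 1) : ℕ) = v at h2 ⊢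
    constructor <;> omega
  have hIr : ∀ n₂ ∈ ((((BFI.dyadic N).filter (fun n : ℕ => IsCoprime (n : ℤ) a₂)).filter (fun n : ℕ => n₀ ∣ n)).image (fun n : ℕ => n / n₀)), a₂.natAbs * n₀ * δ₁ * n₂ ∈ Finset.Icc 1 ⌊2 * ((a₂.natAbs : ℝ) * δ₁ * N)⌋₊ := by
    intro n₂ hn₂
    obtain ⟨hpos, -, hdy⟩ := mem_Bset hN.le hn₀ hn₂
    have h2 := ((BFI.mem_dyadic hN.le).1 hdy).2
    rw [Finset.mem_Icc]
    refine ⟨Nat.one_le_iff_ne_zero.2 (Nat.pos_iff_ne_zero.1 (by positivity)), Nat.le_floor ?_⟩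
    push_cast at h2 ⊢
    have h0 : (0 : ℝ) ≤ (a₂.natAbs : ℝ) * δ₁ := by positivity
    calc (a₂.natAbs : ℝ) * n₀ * δ₁ * n₂ = (a₂.natAbs : ℝ) * δ₁ * ((n₀ : ℝ) * n₂) := by ring
      _ ≤ (a₂.natAbs : ℝ) * δ₁ * (2 * N) := mul_le_mul_of_nonneg_left h2 h0
      _ = 2 * ((a₂.natAbs : ℝ) * δ₁ * N) := by ring
  have hIs : ∀ n₁ ∈ ((((BFI.dyadic N).filter (fun n : ℕ => IsCoprime (n : ℤ) a₂)).filter (fun n : ℕ => n₀ ∣ n)).image (fun n : ℕ => n / n₀)), δ₂ * n₁ ∈ Finset.Icc 1 ⌊2 * ((δ₂ : ℝ) * N / n₀)⌋₊ := by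
    intro n₁ hn₁
    obtain ⟨hpos, -, hdy⟩ := mem_Bset hN.le hn₀ hn₁
    have h2 := ((BFI.mem_dyadic hN.le).1 hdy).2
    rw [Finset.mem_Icc]
    refine ⟨Nat.one_le_iff_ne_zero.2 (Nat.pos_iff_ne_zero.1 (by positivity)), Nat.le_floor ?_⟩
    have hn₀r : (0 : ℝ) < n₀ := by exact_mod_cast hn₀
    rw [show 2 * ((δ₂ : ℝ) * N / n₀) = (δ₂ : ℝ) * (2 * N) / n₀ by ring, le_div_iff₀ hn₀r]
    push_cast at h2 ⊢
    have h0 : (0 : ℝ) ≤ (δ₂ : ℝ) := by positivity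
    calc (δ₂ : ℝ) * n₁ * n₀ = (δ₂ : ℝ) * ((n₀ : ℝ) * n₁) := by ring
      _ ≤ (δ₂ : ℝ) * (2 * N) := mul_le_mul_of_nonneg_left h2 h0
  have h1N : (1 : ℝ) ≤ ((2 ^ (k + 1) : ℕ) : ℝ) := by exact_mod_cast Nat.one_le_two_pow
  -- the identity with the left-hand side of Theorem 2.1
  rw [pieceSumBlk_eq_cruxLHS_pos hN.le ha₂ hq₀ hn₀ hq₀n₀ hq₀a₂ hl₁ hl₂ hl₁lt hl₂lt hδ₁ hδ₂ hδ₁m hδ₂m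
    hc₀ hd₀ hβ ξ H (2 ^ k) (2 ^ (k + 1)) ⌊2 * (9 / 8 * S / ((q₀ : ℝ) * δ₂))⌋₊ ⌊2 * (9 / 8 * S / ((q₀ : ℝ) * δ₁))⌋₊ hIn hIr hIs
    (G := (fun q₁ q₂ : ℕ => pieceHi S Y q₀ q₁ * pieceHi S Y q₀ q₂ *
          alphaProfile ((q₀ : ℝ) * ξ / M * q₁ * q₂)))
    (g := (drWeight (pieceHi S Y ((q₀ : ℝ) * δ₂)) (pieceHi S Y ((q₀ : ℝ) * δ₁))
          ((q₀ : ℝ) * ξ / M * δ₁ * δ₂) ((2 : ℝ) ^ k) ((a₂.natAbs : ℝ) * δ₁ * N) ((δ₂ : ℝ) * N / n₀)))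
    (fun c d n r s h => drWeight_support_HH hY hYS hN ha₂ hq₀ hn₀ hδ₁ hδ₂ k c d n r s h)
    (fun c d n₁ hn₁ n₂ hn₂ h hlo hhi => G_eq_drWeight_HH hN ha₂ hn₀ hδ₁ hδ₂ 1
      (mem_Bset hN.le hn₀ hn₁).2.2 (mem_Bset hN.le hn₀ hn₂).2.2 h hlo hhi)]
  have hbsupp : ∀ n r s : ℕ, (bCoef a₁ a₂ ((((BFI.dyadic N).filter (fun n : ℕ => IsCoprime (n : ℤ) a₂)).filter (fun n : ℕ => n₀ ∣ n)).image (fun n : ℕ => n / n₀)) q₀ n₀ l₁ l₂ β ξ H 1 (2 ^ k) (2 ^ (k + 1)) δ₁ δ₂) n r s ≠ 0 →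
      (0 < n ∧ (n : ℝ) ≤ ((2 ^ (k + 1) : ℕ) : ℝ) ∧ ((a₂.natAbs : ℝ) * δ₁ * N) < r ∧
        (r : ℝ) ≤ 2 * ((a₂.natAbs : ℝ) * δ₁ * N) ∧ ((δ₂ : ℝ) * N / n₀) < s ∧
        (s : ℝ) ≤ 2 * ((δ₂ : ℝ) * N / n₀)) := by
    intro n r s hb
    rw [bCoef_eq_bGen] at hb
    exact bGen_support hN.le ha₂ hn₀ hδ₁ hδ₂ Nat.one_le_two_pow H _ hb
  exact hcrux (9 / 8 * S / ((q₀ : ℝ) * δ₂)) (9 / 8 * S / ((q₀ : ℝ) * δ₁)) ((2 ^ (k + 1) : ℕ) : ℝ) ((a₂.natAbs : ℝ) * δ₁ * N) ((δ₂ : ℝ) * N / n₀)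
    hC1 hD1 h1N hR1 hS1 (a₂.natAbs * n₀) c₀ d₀ hm hcop
    (bCoef a₁ a₂ ((((BFI.dyadic N).filter (fun n : ℕ => IsCoprime (n : ℤ) a₂)).filter (fun n : ℕ => n₀ ∣ n)).image (fun n : ℕ => n / n₀)) q₀ n₀ l₁ l₂ β ξ H 1 (2 ^ k) (2 ^ (k + 1)) δ₁ δ₂) hbsupp
    (drWeight (pieceHi S Y ((q₀ : ℝ) * δ₂)) (pieceHi S Y ((q₀ : ℝ) * δ₁))
          ((q₀ : ℝ) * ξ / M * δ₁ * δ₂) ((2 : ℝ) ^ k) ((a₂.natAbs : ℝ) * δ₁ * N) ((δ₂ : ℝ) * N / n₀)) hgcd hghc hgsup hgder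

/-- **A blocked piece of `ℛ₁''` (pieces `HH`, negative block) is bounded by the right-hand side of
Theorem 2.1** (`𝐪 = |a₂|n₀`, `C = C_j`, `D = C_i`, `𝐍 = 2^{k+1}`, `R = |a₂|δ₁N`, `𝐒 = δ₂N/n₀`).
[cite: Drappeau2017, §5.5 p. 21, (5.24)] -/
theorem blk_le_crux_HH_neg {S Y N M ξ : ℝ} (hY : 0 < Y) (hYS : Y ≤ S / 4) (hN : 0 < N)
    (hM : 0 ≤ M) (hξ : 0 ≤ ξ) {a₁ a₂ : ℤ} (ha₂ : a₂ ≠ 0) {q₀ n₀ : ℕ} (hq₀ : 0 < q₀) (hn₀ : 0 < n₀)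
    (hq₀n₀ : Nat.Coprime q₀ n₀) (hq₀a₂ : IsCoprime (q₀ : ℤ) a₂)
    {l₁ l₂ : ℕ} (hl₁ : Nat.Coprime l₁ (a₂.natAbs * n₀)) (hl₂ : Nat.Coprime l₂ (a₂.natAbs * n₀))
    (hl₁lt : l₁ < a₂.natAbs * n₀) (hl₂lt : l₂ < a₂.natAbs * n₀)
    {δ₁ δ₂ : ℕ} (hδ₁ : 0 < δ₁) (hδ₂ : 0 < δ₂) (hδ₁m : Nat.Coprime δ₁ (a₂.natAbs * n₀))
    (hδ₂m : Nat.Coprime δ₂ (a₂.natAbs * n₀))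
    {β : ℕ → ℂ} (hβ : ∀ n, ¬Squarefree n → β n = 0) (H k : ℕ)
    (hC1 : (1 : ℝ) ≤ (9 / 8 * S / ((q₀ : ℝ) * δ₂))) (hD1 : (1 : ℝ) ≤ (9 / 8 * S / ((q₀ : ℝ) * δ₁)))
    (hR1 : (1 : ℝ) ≤ (a₂.natAbs : ℝ) * δ₁ * N) (hS1 : (1 : ℝ) ≤ (δ₂ : ℝ) * N / n₀)
    {ε₀ Λ : ℝ} (hε₀ : 0 ≤ ε₀) (hε₀1 : ε₀ ≤ 1) (hΛ : 0 ≤ Λ)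
    (hΛt : ∀ t : ℝ, (S - Y) / ((q₀ : ℝ) * ((δ₁ : ℝ) * δ₂)) ≤ t →
      (2 * S + Y) / Y + 29 + 3 ≤ Λ * t ^ ε₀)
    {A e : ℝ}
    (hcrux : (∀ C D N R S : ℝ, 1 ≤ C → 1 ≤ D → 1 ≤ N → 1 ≤ R → 1 ≤ S →
      ∀ q c₀ d₀ : ℕ, 0 < q → Nat.Coprime (c₀ * d₀) q →
      ∀ b : ℕ → ℕ → ℕ → ℂ,
        (∀ n r s : ℕ, b n r s ≠ 0 →
          (0 < n ∧ (n : ℝ) ≤ N ∧ R < r ∧ (r : ℝ) ≤ 2 * R ∧ S < s ∧ (s : ℝ) ≤ 2 * S)) →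
      ∀ g : ℝ → ℝ → ℝ → ℝ → ℝ → ℂ,
        ContDiff ℝ (⊤ : ℕ∞) (fun p : Fin 5 → ℝ => g (p 0) (p 1) (p 2) (p 3) (p 4)) →
        HasCompactSupport (fun p : Fin 5 → ℝ => g (p 0) (p 1) (p 2) (p 3) (p 4)) →
        (∀ c d n r s : ℝ, g c d n r s ≠ 0 →
          (C < c ∧ c ≤ 2 * C ∧ D < d ∧ d ≤ 2 * D ∧ 0 < n ∧ 0 < r ∧ 0 < s)) →
        (∀ ν : Fin 5 → ℕ, ∀ c d n r s : ℝ, 0 < c → 0 < d → 0 < n → 0 < r → 0 < s →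
          ‖mixedDeriv ν g c d n r s‖ ≤ KnuFamily Λ ν *
            (c ^ (-(ν 0 : ℝ)) * d ^ (-(ν 1 : ℝ)) * n ^ (-(ν 2 : ℝ)) * r ^ (-(ν 3 : ℝ)) *
              s ^ (-(ν 4 : ℝ))) ^ (1 - ε₀)) →
        ‖∑ c ∈ Finset.Icc 1 ⌊2 * C⌋₊, ∑ d ∈ Finset.Icc 1 ⌊2 * D⌋₊, ∑ n ∈ Finset.Icc 1 ⌊N⌋₊, ∑ r ∈ Finset.Icc 1 ⌊2 * R⌋₊,
            ∑ s ∈ Finset.Icc 1 ⌊2 * S⌋₊,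
            (if (c ≡ c₀ [MOD q] ∧ d ≡ d₀ [MOD q] ∧ Nat.Coprime (q * r * d) (s * c)) then
              b n r s * g c d n r s *
                (𝐞 ((n : ℝ) * ((((r * d : ℕ) : ZMod (s * c))⁻¹).val : ℝ) / ((s : ℝ) * c)) : ℂ)
            else 0)‖ ≤
          A * ((q : ℝ) * C * D * N * R * S) ^ e * (q : ℝ) ^ (3 / 2 : ℝ) *
            Real.sqrt
              ((q : ℝ) ^ 2 * (C * S * (R * S + N) * (C + R * D) + S * N * R) *
                  (∑ n ∈ Finset.Icc 1 ⌊N⌋₊, ∑ r ∈ Finset.Icc 1 ⌊2 * R⌋₊, ∑ s ∈ Finset.Icc 1 ⌊2 * S⌋₊, ‖b n r s‖ ^ 2) +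
                (q : ℝ) * (C ^ 2 * D * S * Real.sqrt (R * (R * S + N)) + D ^ 2 * N * R) *
                  (∑ n ∈ Finset.Icc 1 ⌊N⌋₊, ∑ r ∈ Finset.Icc 1 ⌊2 * R⌋₊, ∑ s ∈ Finset.Icc 1 ⌊2 * S⌋₊, ‖b n r s‖ ^ 2)))) :
    ‖pieceSumBlk a₁ a₂ (((((((BFI.mRange S Y).filter (fun q : ℕ => 0 < q)).filter (fun q : ℕ => IsCoprime (q : ℤ) a₂)).filter (fun q : ℕ => q₀ ∣ q)).image (fun q : ℕ => q / q₀)).filter (fun q : ℕ => q % (a₂.natAbs * n₀) = l₁)).filter (fun q : ℕ => δ₁ ∣ q))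
        (((((((BFI.mRange S Y).filter (fun q : ℕ => 0 < q)).filter (fun q : ℕ => IsCoprime (q : ℤ) a₂)).filter (fun q : ℕ => q₀ ∣ q)).image (fun q : ℕ => q / q₀)).filter (fun q : ℕ => q % (a₂.natAbs * n₀) = l₂)).filter (fun q : ℕ => δ₂ ∣ q)) ((((BFI.dyadic N).filter (fun n : ℕ => IsCoprime (n : ℤ) a₂)).filter (fun n : ℕ => n₀ ∣ n)).image (fun n : ℕ => n / n₀))
        q₀ n₀ l₁ l₂ β ξ (fun q₁ q₂ : ℕ => pieceHi S Y q₀ q₁ * pieceHi S Y q₀ q₂ *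
          alphaProfile ((q₀ : ℝ) * ξ / M * q₁ * q₂)) H (-1) (2 ^ k) (2 ^ (k + 1))‖ ≤
      A * (((a₂.natAbs * n₀ : ℕ) : ℝ) * (9 / 8 * S / ((q₀ : ℝ) * δ₂)) * (9 / 8 * S / ((q₀ : ℝ) * δ₁)) * ((2 ^ (k + 1) : ℕ) : ℝ) * ((a₂.natAbs : ℝ) * δ₁ * N) * ((δ₂ : ℝ) * N / n₀)) ^ e * ((a₂.natAbs * n₀ : ℕ) : ℝ) ^ (3 / 2 : ℝ) *
        Real.sqrt (((a₂.natAbs * n₀ : ℕ) : ℝ) ^ 2 * ((9 / 8 * S / ((q₀ : ℝ) * δ₂)) * ((δ₂ : ℝ) * N / n₀) * (((a₂.natAbs : ℝ) * δ₁ * N) * ((δ₂ : ℝ) * N / n₀) + ((2 ^ (k + 1) : ℕ) : ℝ)) * ((9 / 8 * S / ((q₀ : ℝ) * δ₂)) + ((a₂.natAbs : ℝ) * δ₁ * N) * (9 / 8 * S / ((q₀ : ℝ) * δ₁))) + ((δ₂ : ℝ) * N / n₀) * ((2 ^ (k + 1) : ℕ) : ℝ) * ((a₂.natAbs : ℝ)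 * δ₁ * N)) *
              (∑ n ∈ Finset.Icc 1 ⌊((2 ^ (k + 1) : ℕ) : ℝ)⌋₊, ∑ r ∈ Finset.Icc 1 ⌊2 * ((a₂.natAbs : ℝ) * δ₁ * N)⌋₊, ∑ s ∈ Finset.Icc 1 ⌊2 * ((δ₂ : ℝ) * N / n₀)⌋₊, ‖(bGen a₁ a₂ ((((BFI.dyadic N).filter (fun n : ℕ => IsCoprime (n : ℤ) a₂)).filter (fun n : ℕ => n₀ ∣ n)).image (fun n : ℕ => n / n₀)) q₀ n₀ H (-1) (2 ^ k) (2 ^ (k + 1)) δ₁ δ₂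
            (fun h n₁ n₂ => starRingEnd ℂ (β (n₀ * n₁) * starRingEnd ℂ (β (n₀ * n₂)) *
              ((𝐞 (-(ξ * h)) : ℂ) *
                (𝐞 (-((h : ℝ) * a₁ *
                    ((((((q₀ : ℤ) * l₁ * l₂ * n₁ : ℤ) : ZMod (a₂.natAbs * n₀))⁻¹).val : ℕ) : ℝ) /
                      ((a₂ : ℝ) * n₀))) : ℂ))))) n r s‖ ^ 2) +
            ((a₂.natAbs * n₀ : ℕ) : ℝ) * ((9 / 8 * S / ((q₀ : ℝ) * δ₂)) ^ 2 * (9 / 8 * S / ((q₀ : ℝ) * δ₁)) * ((δ₂ : ℝ) * N / n₀) * Real.sqrt (((a₂.natAbs : ℝ) * δ₁ * N) * (((a₂.natAbs : ℝ) * δ₁ * N) * ((δ₂ : ℝ) * N / n₀) + ((2 ^ (k + 1) : ℕ) : ℝ))) + (9 / 8 * S / ((q₀ : ℝ) * δ₁)) ^ 2 * ((2 ^ (k + 1) : ℕ) : ℝ) * ((a₂.natAbs : ℝ) * δ₁ * N)) *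
              (∑ n ∈ Finset.Icc 1 ⌊((2 ^ (k + 1) : ℕ) : ℝ)⌋₊, ∑ r ∈ Finset.Icc 1 ⌊2 * ((a₂.natAbs : ℝ) * δ₁ * N)⌋₊, ∑ s ∈ Finset.Icc 1 ⌊2 * ((δ₂ : ℝ) * N / n₀)⌋₊, ‖(bGen a₁ a₂ ((((BFI.dyadic N).filter (fun n : ℕ => IsCoprime (n : ℤ) a₂)).filter (fun n : ℕ => n₀ ∣ n)).image (fun n : ℕ => n / n₀)) q₀ n₀ H (-1) (2 ^ k) (2 ^ (k + 1)) δ₁ δ₂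
            (fun h n₁ n₂ => starRingEnd ℂ (β (n₀ * n₁) * starRingEnd ℂ (β (n₀ * n₂)) *
              ((𝐞 (-(ξ * h)) : ℂ) *
                (𝐞 (-((h : ℝ) * a₁ *
                    ((((((q₀ : ℤ) * l₁ * l₂ * n₁ : ℤ) : ZMod (a₂.natAbs * n₀))⁻¹).val : ℕ) : ℝ) /
                      ((a₂ : ℝ) * n₀))) : ℂ))))) n r s‖ ^ 2)) := by
  have hm : 0 < a₂.natAbs * n₀ := Nat.mul_pos (Int.natAbs_pos.2 ha₂) hn₀
  haveI : NeZero (a₂.natAbs * n₀) := ⟨hm.ne'⟩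
  -- the classes `c₀ = λ₂ δ₂⁻¹`, `d₀ = λ₁ δ₁⁻¹`
  have hδ₂u : IsUnit ((δ₂ : ℕ) : ZMod (a₂.natAbs * n₀)) := (ZMod.isUnit_iff_coprime _ _).2 hδ₂m
  have hδ₁u : IsUnit ((δ₁ : ℕ) : ZMod (a₂.natAbs * n₀)) := (ZMod.isUnit_iff_coprime _ _).2 hδ₁m
  have hl₂u : IsUnit ((l₂ : ℕ) : ZMod (a₂.natAbs * n₀)) := (ZMod.isUnit_iff_coprime _ _).2 hl₂
  have hl₁u : IsUnit ((l₁ : ℕ) : ZMod (a₂.natAbs * n₀)) := (ZMod.isUnit_iff_coprime _ _).2 hl₁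
  set c₀ : ℕ := (((l₂ : ℕ) : ZMod (a₂.natAbs * n₀)) * (((δ₂ : ℕ) : ZMod (a₂.natAbs * n₀)))⁻¹).val
    with hc₀def
  set d₀ : ℕ := (((l₁ : ℕ) : ZMod (a₂.natAbs * n₀)) * (((δ₁ : ℕ) : ZMod (a₂.natAbs * n₀)))⁻¹).val
    with hd₀def
  have hc₀ : δ₂ * c₀ ≡ l₂ [MOD a₂.natAbs * n₀] := by
    rw [← ZMod.natCast_eq_natCast_iff, Nat.cast_mul, hc₀def, ZMod.natCast_zmod_val, mul_left_comm,
      ZMod.mul_inv_of_unit _ hδ₂u, mul_one]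
  have hd₀ : δ₁ * d₀ ≡ l₁ [MOD a₂.natAbs * n₀] := by
    rw [← ZMod.natCast_eq_natCast_iff, Nat.cast_mul, hd₀def, ZMod.natCast_zmod_val, mul_left_comm,
      ZMod.mul_inv_of_unit _ hδ₁u, mul_one]
  have hcop : Nat.Coprime (c₀ * d₀) (a₂.natAbs * n₀) := by
    refine Nat.Coprime.mul_left ?_ ?_
    · rw [← ZMod.isUnit_iff_coprime, hc₀def, ZMod.natCast_zmod_val]
      exact hl₂u.mul (IsUnit.of_mul_eq_one _ (ZMod.inv_mul_of_unit _ hδ₂u))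
    · rw [← ZMod.isUnit_iff_coprime, hd₀def, ZMod.natCast_zmod_val]
      exact hl₁u.mul (IsUnit.of_mul_eq_one _ (ZMod.inv_mul_of_unit _ hδ₁u))
  -- the weight
  obtain ⟨hgcd, hghc, hgsup, hgder⟩ := drWeight_cruxHyps_HH hY hYS hq₀ hδ₁ hδ₂
    (κ := (q₀ : ℝ) * ξ / M * δ₁ * δ₂) (R := (a₂.natAbs : ℝ) * δ₁ * N) (S' := (δ₂ : ℝ) * N / n₀)
    (by positivity) hR1 hS1 k hε₀ hε₀1 hΛ hΛt
  -- ranges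
  have hIn : ∀ z : ℤ, (((2 ^ k : ℕ) : ℕ) : ℤ) ≤ z → z < (((2 ^ (k + 1) : ℕ) : ℕ) : ℤ) →
      z.toNat ∈ Finset.Icc 1 ⌊((2 ^ (k + 1) : ℕ) : ℝ)⌋₊ := by
    intro z h1 h2
    rw [Nat.floor_natCast, Finset.mem_Icc]
    have hk1 : 1 ≤ 2 ^ k := Nat.one_le_two_pow
    generalize (2 ^ k : ℕ) = u at h1 hk1
    generalize (2 ^ (k + 1) : ℕ) = v at h2 ⊢
    constructor <;> omega
  have hIr : ∀ n₂ ∈ ((((BFI.dyadic N).filter (fun n : ℕ => IsCoprime (n : ℤ) a₂)).filter (fun n : ℕ => n₀ ∣ n)).image (fun n : ℕ => n / n₀)), a₂.natAbs * n₀ * δ₁ * n₂ ∈ Finset.Icc 1 ⌊2 * ((a₂.natAbs : ℝ) * δ₁ * N)⌋₊ := by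
    intro n₂ hn₂
    obtain ⟨hpos, -, hdy⟩ := mem_Bset hN.le hn₀ hn₂
    have h2 := ((BFI.mem_dyadic hN.le).1 hdy).2
    rw [Finset.mem_Icc]
    refine ⟨Nat.one_le_iff_ne_zero.2 (Nat.pos_iff_ne_zero.1 (by positivity)), Nat.le_floor ?_⟩
    push_cast at h2 ⊢
    have h0 : (0 : ℝ) ≤ (a₂.natAbs : ℝ) * δ₁ := by positivity
    calc (a₂.natAbs : ℝ) * n₀ * δ₁ * n₂ = (a₂.natAbs : ℝ) * δ₁ * ((n₀ : ℝ) * n₂) := by ring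
      _ ≤ (a₂.natAbs : ℝ) * δ₁ * (2 * N) := mul_le_mul_of_nonneg_left h2 h0
      _ = 2 * ((a₂.natAbs : ℝ) * δ₁ * N) := by ring
  have hIs : ∀ n₁ ∈ ((((BFI.dyadic N).filter (fun n : ℕ => IsCoprime (n : ℤ) a₂)).filter (fun n : ℕ => n₀ ∣ n)).image (fun n : ℕ => n / n₀)), δ₂ * n₁ ∈ Finset.Icc 1 ⌊2 * ((δ₂ : ℝ) * N / n₀)⌋₊ := by
    intro n₁ hn₁
    obtain ⟨hpos, -, hdy⟩ := mem_Bset hN.le hn₀ hn₁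
    have h2 := ((BFI.mem_dyadic hN.le).1 hdy).2
    rw [Finset.mem_Icc]
    refine ⟨Nat.one_le_iff_ne_zero.2 (Nat.pos_iff_ne_zero.1 (by positivity)), Nat.le_floor ?_⟩
    have hn₀r : (0 : ℝ) < n₀ := by exact_mod_cast hn₀
    rw [show 2 * ((δ₂ : ℝ) * N / n₀) = (δ₂ : ℝ) * (2 * N) / n₀ by ring, le_div_iff₀ hn₀r]
    push_cast at h2 ⊢
    have h0 : (0 : ℝ) ≤ (δ₂ : ℝ) := by positivity
    calc (δ₂ : ℝ) * n₁ * n₀ = (δ₂ : ℝ) * ((n₀ : ℝ) * n₁) := by ring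
      _ ≤ (δ₂ : ℝ) * (2 * N) := mul_le_mul_of_nonneg_left h2 h0
  have h1N : (1 : ℝ) ≤ ((2 ^ (k + 1) : ℕ) : ℝ) := by exact_mod_cast Nat.one_le_two_pow
  -- conjugate, then the identity with the left-hand side of Theorem 2.1
  rw [← Complex.norm_conj (pieceSumBlk a₁ a₂ (((((((BFI.mRange S Y).filter (fun q : ℕ => 0 < q)).filter (fun q : ℕ => IsCoprime (q : ℤ) a₂)).filter (fun q : ℕ => q₀ ∣ q)).image (fun q : ℕ => q / q₀)).filter (fun q : ℕ => q % (a₂.natAbs * n₀) = l₁)).filter (fun q : ℕ => δ₁ ∣ q))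
        (((((((BFI.mRange S Y).filter (fun q : ℕ => 0 < q)).filter (fun q : ℕ => IsCoprime (q : ℤ) a₂)).filter (fun q : ℕ => q₀ ∣ q)).image (fun q : ℕ => q / q₀)).filter (fun q : ℕ => q % (a₂.natAbs * n₀) = l₂)).filter (fun q : ℕ => δ₂ ∣ q)) ((((BFI.dyadic N).filter (fun n : ℕ => IsCoprime (n : ℤ) a₂)).filter (fun n : ℕ => n₀ ∣ n)).image (fun n : ℕ => n / n₀))
        q₀ n₀ l₁ l₂ β ξ (fun q₁ q₂ : ℕ => pieceHi S Y q₀ q₁ * pieceHi S Y q₀ q₂ *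
          alphaProfile ((q₀ : ℝ) * ξ / M * q₁ * q₂)) H (-1) (2 ^ k) (2 ^ (k + 1)))]
  rw [conj_pieceSumBlk_eq_cruxLHS_neg hN.le ha₂ hq₀ hn₀ hq₀n₀ hq₀a₂ hl₁ hl₂ hl₁lt hl₂lt hδ₁ hδ₂ hδ₁m hδ₂m
    hc₀ hd₀ hβ ξ H (2 ^ k) (2 ^ (k + 1)) ⌊2 * (9 / 8 * S / ((q₀ : ℝ) * δ₂))⌋₊ ⌊2 * (9 / 8 * S / ((q₀ : ℝ) * δ₁))⌋₊ hIn hIr hIs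
    (G := (fun q₁ q₂ : ℕ => pieceHi S Y q₀ q₁ * pieceHi S Y q₀ q₂ *
          alphaProfile ((q₀ : ℝ) * ξ / M * q₁ * q₂)))
    (g := (drWeight (pieceHi S Y ((q₀ : ℝ) * δ₂)) (pieceHi S Y ((q₀ : ℝ) * δ₁))
          ((q₀ : ℝ) * ξ / M * δ₁ * δ₂) ((2 : ℝ) ^ k) ((a₂.natAbs : ℝ) * δ₁ * N) ((δ₂ : ℝ) * N / n₀)))
    (fun c d n r s h => drWeight_support_HH hY hYS hN ha₂ hq₀ hn₀ hδ₁ hδ₂ k c d n r s h)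
    (conj_G_HH S Y ξ M q₀)
    (fun c d n₁ hn₁ n₂ hn₂ h hlo hhi => G_eq_drWeight_HH hN ha₂ hn₀ hδ₁ hδ₂ (-1)
      (mem_Bset hN.le hn₀ hn₁).2.2 (mem_Bset hN.le hn₀ hn₂).2.2 h hlo hhi)]
  have hbsupp : ∀ n r s : ℕ, (bGen a₁ a₂ ((((BFI.dyadic N).filter (fun n : ℕ => IsCoprime (n : ℤ) a₂)).filter (fun n : ℕ => n₀ ∣ n)).image (fun n : ℕ => n / n₀)) q₀ n₀ H (-1) (2 ^ k) (2 ^ (k + 1)) δ₁ δ₂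
            (fun h n₁ n₂ => starRingEnd ℂ (β (n₀ * n₁) * starRingEnd ℂ (β (n₀ * n₂)) *
              ((𝐞 (-(ξ * h)) : ℂ) *
                (𝐞 (-((h : ℝ) * a₁ *
                    ((((((q₀ : ℤ) * l₁ * l₂ * n₁ : ℤ) : ZMod (a₂.natAbs * n₀))⁻¹).val : ℕ) : ℝ) /
                      ((a₂ : ℝ) * n₀))) : ℂ))))) n r s ≠ 0 →
      (0 < n ∧ (n : ℝ) ≤ ((2 ^ (k + 1) : ℕ) : ℝ) ∧ ((a₂.natAbs : ℝ) * δ₁ * N) < r ∧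
        (r : ℝ) ≤ 2 * ((a₂.natAbs : ℝ) * δ₁ * N) ∧ ((δ₂ : ℝ) * N / n₀) < s ∧
        (s : ℝ) ≤ 2 * ((δ₂ : ℝ) * N / n₀)) :=
    fun n r s hb => bGen_support hN.le ha₂ hn₀ hδ₁ hδ₂ Nat.one_le_two_pow H _ hb
  exact hcrux (9 / 8 * S / ((q₀ : ℝ) * δ₂)) (9 / 8 * S / ((q₀ : ℝ) * δ₁)) ((2 ^ (k + 1) : ℕ) : ℝ) ((a₂.natAbs : ℝ) * δ₁ * N) ((δ₂ : ℝ) * N / n₀)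
    hC1 hD1 h1N hR1 hS1 (a₂.natAbs * n₀) c₀ d₀ hm hcop
    (bGen a₁ a₂ ((((BFI.dyadic N).filter (fun n : ℕ => IsCoprime (n : ℤ) a₂)).filter (fun n : ℕ => n₀ ∣ n)).image (fun n : ℕ => n / n₀)) q₀ n₀ H (-1) (2 ^ k) (2 ^ (k + 1)) δ₁ δ₂
            (fun h n₁ n₂ => starRingEnd ℂ (β (n₀ * n₁) * starRingEnd ℂ (β (n₀ * n₂)) *
              ((𝐞 (-(ξ * h)) : ℂ) *
                (𝐞 (-((h : ℝ) * a₁ *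
                    ((((((q₀ : ℤ) * l₁ * l₂ * n₁ : ℤ) : ZMod (a₂.natAbs * n₀))⁻¹).val : ℕ) : ℝ) /
                      ((a₂ : ℝ) * n₀))) : ℂ))))) hbsupp
    (drWeight (pieceHi S Y ((q₀ : ℝ) * δ₂)) (pieceHi S Y ((q₀ : ℝ) * δ₁))
          ((q₀ : ℝ) * ξ / M * δ₁ * δ₂) ((2 : ℝ) ^ k) ((a₂.natAbs : ℝ) * δ₁ * N) ((δ₂ : ℝ) * N / n₀)) hgcd hghc hgsup hgder

end Drappeau2017

end Literature.NumberTheory.Sieve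

end
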